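import Literature.NumberTheory.EllipticCurves.HalfIntegralWeightFormsProofs
import Literature.NumberTheory.EllipticCurves.TwistedLValueSeries
import HarnessLib

/-!
# The Fricke involution `z ↦ -1/(Nz)` commutes with the Hecke operators `T(p²)` of
# half-integral weight, up to `χ̄(p²)`

For `8 ∣ N`, an odd weight `k/2` (`k` odd), a character `χ` modulo `N` and a prime `p ∤ N`, let
`(W f)(z) = (-iz)^{-k/2} f(-1/(Nz))` (`frickeFun`, principal branch `(-iz)^{-k/2} = √(-iz)^{-k}`)
be the Fricke involution of level `N` on functions, and let `T(p²)` be Shimura's Hecke operator,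
realised on functions by the explicit average `heckeFun k χ p` of
`HalfIntegralWeightFormsProofs` (`p⁻² [Σ_b f((z+b)/p²) + χ(p)(ε_p⁻¹√p)^k Σ_t (t/p) f(z + t/p)
+ χ(p²) p^k f(p²z)]`, whose `q`-expansion is `heckeTSq k χ p`, Shimura 1973 Thm. 1.7). We PROVE

* `heckeFun_frickeFun` — **`T_{χ'}(p²)(W f) = χ̄(p)² · W(T_χ(p²) f)`** for every `f` with the
  automorphy `f(γz) = χ(d) j(γ,z)^k f(z)` on `Γ₀(N)`, where `χ'` is any character modulo `N`
  with `χ'(p) = χ̄(p) (N/p)` (the character `χ̄ (N/4 / ·)` of the target space `W M_{k/2}(N, χ)`;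
  for `N = 128`: `χ' = χ χ₂`);
* `heckeTSq_eq_smul_of_frickeFun` — **transfer of eigenvalues**: if `f ∈ M_{k/2}(N, χ)`,
  `g ∈ M_{k/2}(N, χ')`, `W f = c g` with `c ≠ 0`, and `T(p²) f = λ f` on `q`-expansions, then
  `T(p²) g = χ̄(p)² λ g` on `q`-expansions.

This is the half-integral weight case of the classical fact that the involution attached to
`(0, -1; N, 0)` normalises `Γ₀(N)` and the double coset `Γ₀(N) diag(1, p²) Γ₀(N)` and so
commutes with `T(p²)` up to the character (Shimura 1973, §1, Prop. 1.5 with the element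
`τ = (0, -1; N, 0)·√N^{1/2}` of the covering group). It is the structural input that carries
the `T(p²)`-eigenvalue `a_p(E)` of Tunnell's `g θ₈ ∈ S_{3/2}(128, 1)` (proved in
`TunnellThmTwoOrdinaryProofs`) to `g θ₄ ∈ S_{3/2}(128, χ₂)` (`W(g θ₈) = 32 (-iz)^{3/2} g θ₄`,
`TunnellFormsFrickeProofs`), i.e. to Tunnell 1983, Theorem 2 for the character `χ₂`.

## Proof

A direct matching of the `p² + p + 1` terms of the two averages (no appeal to double cosets):
with `u = W z` (so `z = -1/(Nu)`),

* `(W f)(p² z) ↔ f(u/p²)` and `(W f)(z/p²) ↔ f(p² u)` (`frickeFun_mulPSq`, `frickeFun_divPSq`);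
* units `b (mod p²)`: `W((z+b)/p²) = γ_b ((u + b')/p²)` with `b' = -(Nb)⁻¹ (mod p²)`,
  `γ_b = (p², -b'; -Nb, D_b) ∈ Γ₀(N)`, `D_b p² = 1 + N b b'`; here `χ(D_b) = χ̄(p)²`,
  `ε_{D_b} = 1` (`D_b ≡ 1 (mod 8)`, which is where `8 ∣ N` is used) and `(-Nb / D_b) = 1`
  (`frickeFun_transDiv_unit`);
* multiples `ps` (`s ≢ 0 (mod p)`) and translates `z + t/p`: `W((z+ps)/p²) = δ_s (u + s'/p)` and
  `W(z + t/p) = δ_t ((u + p t')/p²)` with `s' = -(Ns)⁻¹ (mod p)`,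
  `δ_s = (p, -s'; -Ns, D_s) ∈ Γ₀(N)`, `D_s p = 1 + N s s'`; here `χ(D_s) = χ̄(p)`, `ε_{D_s} = ε_p`,
  `(-Ns / D_s) = (-Ns / p) = (s'/p)` — the Legendre twist of the middle term appears from the
  symbol of the cofactor — so the `ps`-terms of `T(p²)(W f)` give the twisted sum of
  `W(T(p²) f)` and vice versa, with the constants `(ε_p⁻¹√p)^k` and
  `χ'(p) ε_p^{-2k} (-1/p)(N/p) = χ̄(p)` (`frickeFun_transDiv_bOfS`, `frickeFun_vadd`).

The symbols are evaluated by the lemma `(-c / n) = 1` for `8 ∣ c`, `n ≡ 1 (mod c)`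
(`jacobiSym_neg_eq_one_of_dvd`, quadratic reciprocity in Mathlib's form `jacobiSym.mod_right'`),
applied to `n = D_b p² = 1 + N b b'` and `n = D_s p = 1 + N s s'`; the square roots by
`√(a/c) = √a/√c` for `Re a, Re c > 0` (`csqrt_div_of_re_pos`), the radicand `c v + d` of each
cofactor being `(-iw)/(-iz)` times `1`, `p` or `1/p`. The regrouping of the sums uses the
involutions `b ↦ b'` of `(ℤ/p²)ˣ` and `s ↦ s'` of `ℤ/p`.

## Main statements

* `frickeFun`: `(W f)(z) = √(-iz)^{-k} f(W_N z)` (`W_N z = frickePoint N z = -1/(Nz)` of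
  `TwistedLValueSeries`).
* `heckeFun_frickeFun`: `T_{χ'}(p²)(W f) = χ̄(p)² W(T_χ(p²) f)`.
* `heckeTSq_eq_smul_of_frickeFun`: eigenvalues transfer along `W` (up to `χ̄(p)²`).

## References

* G. Shimura, *On modular forms of half integral weight*, Ann. of Math. 97 (1973) 440–481, §1
  (the covering group, the element over `(0, -1; N, 0)`, Prop. 1.5: `τ Δ₀(N) ξ Δ₀(N) τ⁻¹`) and
  Thm. 1.7 (`T(p²)` on `q`-expansions). [Shimura1973HalfIntegral]
* N. Koblitz, *Introduction to Elliptic Curves and Modular Forms*, GTM 97, Ch. IV §3,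
  Prop. 13 (the explicit average for `T(p²)`) and Problem 16 (the operator `W_N` in
  half-integral weight).
* J. B. Tunnell, *A classical Diophantine problem and modular forms of weight 3/2*, Invent. Math.
  72 (1983) 323–334, proof of Thm. 2 (the application). [Tunnell1983Congruent]
-/

noncomputable section

open UpperHalfPlane hiding I
open Complex ModularGroup Matrix.SpecialLinearGroup CongruenceSubgroup
open scoped MatrixGroups Real NumberTheorySymbols

namespace Literature.NumberTheory.EllipticCurves.ModularForms

/-! ## Part 1. The Fricke point `-1/(Nz)`, the factor `(-iz)^{1/2}` and `W f` -/

section FrickeA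

-- The Fricke point `frickePoint N z = -1/(Nz) ∈ ℍ` (`W_N z`) and `coe_frickePoint` are those of
-- `TwistedLValueSeries` (same namespace).

variable {N : ℕ} [NeZero N]

omit [NeZero N] in
/-- `N ≠ 0` in `ℂ`. [folklore] -/
theorem natCast_N_ne_zero [NeZero N] : (N : ℂ) ≠ 0 := by exact_mod_cast NeZero.ne N

/-- `W_N (W_N z) = z`. [folklore] -/
theorem frickePoint_frickePoint (z : ℍ) : frickePoint N (frickePoint N z) = z := by
  apply UpperHalfPlane.ext
  rw [coe_frickePoint, coe_frickePoint]
  have hz := UpperHalfPlane.ne_zero z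
  have hN := natCast_N_ne_zero (N := N)
  field_simp

/-- `-iz` has positive real part for `z ∈ ℍ`. [folklore] -/
theorem re_neg_I_mul_pos (z : ℍ) : 0 < (-I * (z : ℂ)).re := by
  simpa using z.im_pos

/-- `√(-iz) ≠ 0` for `z ∈ ℍ`. [folklore] -/
theorem csqrt_neg_I_mul_ne_zero (z : ℍ) : Complex.sqrt (-I * (z : ℂ)) ≠ 0 := by
  intro h
  have h1 : -I * (z : ℂ) = 0 := by rw [← csqrt_sq (-I * (z : ℂ)), h]; ring
  exact mul_ne_zero (neg_ne_zero.mpr I_ne_zero) (UpperHalfPlane.ne_zero z) h1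

omit [NeZero N] in
/-- **`√(a/c) = √a / √c` when `a` and `c` have positive real part** (no branch crossing: both
square roots lie in the sector `|arg| < π/4`). [folklore] -/
theorem csqrt_div_of_re_pos {a c : ℂ} (ha : 0 < a.re) (hc : 0 < c.re) :
    Complex.sqrt (a / c) = Complex.sqrt a / Complex.sqrt c := by
  -- `√x = u + iv` with `u > |v|` when `Re x > 0`
  have key : ∀ {x : ℂ}, 0 < x.re → |(Complex.sqrt x).im| < (Complex.sqrt x).re := by
    intro x hx
    have h1 : (Complex.sqrt x ^ 2).re = x.re := by rw [csqrt_sq]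
    rw [sq, Complex.mul_re] at h1
    have hx0 := csqrt_re_nonneg x
    have h2 : (Complex.sqrt x).im ^ 2 < (Complex.sqrt x).re ^ 2 := by nlinarith
    exact abs_lt_of_sq_lt_sq h2 hx0
  have hc0 : Complex.sqrt c ≠ 0 := by
    intro h; have := key hc; rw [h] at this; simp at this
  apply csqrt_eq_of_sq_eq'
  · rw [div_pow, csqrt_sq, csqrt_sq]
  · left
    rw [div_eq_mul_inv, Complex.mul_re, Complex.inv_re, Complex.inv_im]
    have ha' := key ha
    have hc' := key hc
    have hn : 0 < Complex.normSq (Complex.sqrt c) := Complex.normSq_pos.mpr hc0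
    rw [show (Complex.sqrt a).re * ((Complex.sqrt c).re / Complex.normSq (Complex.sqrt c)) -
        (Complex.sqrt a).im * (-(Complex.sqrt c).im / Complex.normSq (Complex.sqrt c)) =
        ((Complex.sqrt a).re * (Complex.sqrt c).re + (Complex.sqrt a).im * (Complex.sqrt c).im) /
          Complex.normSq (Complex.sqrt c) by ring]
    apply div_pos _ hn
    have h3 : |(Complex.sqrt a).im| * |(Complex.sqrt c).im| <
        (Complex.sqrt a).re * (Complex.sqrt c).re :=
      mul_lt_mul'' ha' hc' (abs_nonneg _) (abs_nonneg _)
    have h4 : -((Complex.sqrt a).im * (Complex.sqrt c).im) ≤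
        |(Complex.sqrt a).im| * |(Complex.sqrt c).im| := by
      rw [← abs_mul]; exact neg_le_abs _
    linarith

omit [NeZero N] in
/-- `√(-iw) = √(-iz) · √((-iw)/(-iz))` for `z, w ∈ ℍ`. [folklore] -/
theorem csqrt_neg_I_mul_eq (z w : ℍ) :
    Complex.sqrt (-I * (w : ℂ)) =
      Complex.sqrt (-I * (z : ℂ)) * Complex.sqrt ((-I * (w : ℂ)) / (-I * (z : ℂ))) := by
  rw [csqrt_div_of_re_pos (re_neg_I_mul_pos w) (re_neg_I_mul_pos z),
    mul_div_cancel₀ _ (csqrt_neg_I_mul_ne_zero z)]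

variable (N) in
/-- **The Fricke involution on functions of weight `k/2`**:
`(W f)(z) = (-iz)^{-k/2} f(-1/(Nz))`, `(-iz)^{-k/2} = (√(-iz))^{-k}` with the principal square
root (Shimura 1973, §1, the operator attached to `(0, -1; N, 0)`, up to a constant).
[cite: Shimura1973HalfIntegral, §1] -/
def frickeFun (k : ℕ) (f : ℍ → ℂ) (z : ℍ) : ℂ :=
  (Complex.sqrt (-I * (z : ℂ)))⁻¹ ^ k * f (frickePoint N z)

/-- `W (c f) = c W f`. [folklore] -/
theorem frickeFun_const_mul (k : ℕ) (c : ℂ) (f : ℍ → ℂ) (z : ℍ) :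
    frickeFun N k (fun w ↦ c * f w) z = c * frickeFun N k f z := by
  unfold frickeFun; ring

/-! ### Three coordinate identities (the Möbius computations behind the point identities) -/

omit [NeZero N] in
/-- Coordinates, unit case: `-1/(N (z+b)/p²) = γ_b · ((u + b')/p²)` with `u = -1/(Nz)`,
`γ_b = (p², -b'; -Nb, (1 + N b b')/p²)`. [folklore] -/
theorem fricke_coord_unit (z b b' M q : ℂ) (hz : z ≠ 0) (hM : M ≠ 0) (hq : q ≠ 0)
    (hzb : z + b ≠ 0) :
    -1 / (M * ((z + b) / q ^ 2)) =
      (q ^ 2 * ((-1 / (M * z) + b') / q ^ 2) + -b') /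
        (-(M * b) * ((-1 / (M * z) + b') / q ^ 2) + (1 + M * b * b') / q ^ 2) := by
  have hnum : q ^ 2 * ((-1 / (M * z) + b') / q ^ 2) + -b' = -1 / (M * z) := by
    field_simp; ring
  have hden : -(M * b) * ((-1 / (M * z) + b') / q ^ 2) + (1 + M * b * b') / q ^ 2 =
      (z + b) / (z * q ^ 2) := by
    field_simp; ring
  rw [hnum, hden]
  field_simp

omit [NeZero N] in
/-- Coordinates, case `p s`: `-1/(N (z+ps)/p²) = δ_s · (s'/p + u)`. [folklore] -/
theorem fricke_coord_bOfS (z s s' M q : ℂ) (hz : z ≠ 0) (hM : M ≠ 0) (hq : q ≠ 0)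
    (hzb : q * s + z ≠ 0) :
    -1 / (M * ((z + q * s) / q ^ 2)) =
      (q * (s' / q + -1 / (M * z)) + -s') /
        (-(M * s) * (s' / q + -1 / (M * z)) + (1 + M * s * s') / q) := by
  have hnum : q * (s' / q + -1 / (M * z)) + -s' = -q / (M * z) := by
    field_simp; ring
  have hden : -(M * s) * (s' / q + -1 / (M * z)) + (1 + M * s * s') / q =
      (q * s + z) / (q * z) := by
    field_simp; ring
  rw [hnum, hden, show z + q * s = q * s + z by ring]
  field_simp

omit [NeZero N] in
/-- Coordinates, translate case: `-1/(N (t/p + z)) = δ_t · ((u + p t')/p²)`. [folklore] -/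
theorem fricke_coord_vadd (z t t' M q : ℂ) (hz : z ≠ 0) (hM : M ≠ 0) (hq : q ≠ 0)
    (hzb : q * z + t ≠ 0) :
    -1 / (M * (t / q + z)) =
      (q * ((-1 / (M * z) + q * t') / q ^ 2) + -t') /
        (-(M * t) * ((-1 / (M * z) + q * t') / q ^ 2) + (1 + M * t * t') / q) := by
  have hnum : q * ((-1 / (M * z) + q * t') / q ^ 2) + -t' = -1 / (M * z * q) := by
    field_simp; ring
  have hden : -(M * t) * ((-1 / (M * z) + q * t') / q ^ 2) + (1 + M * t * t') / q =
      (q * z + t) / (z * q ^ 2) := by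
    field_simp; ring
  rw [hnum, hden, show t / q + z = (q * z + t) / q by field_simp; ring]
  field_simp

end FrickeA

/-! ## Part 2. A reciprocity lemma: `(-c/n) = 1` for `8 ∣ c` and `n ≡ 1 (mod c)` -/

section Reciprocity

/-- For `8 ∣ c` and `n ≡ 1 (mod c)`: `(-c / n) = 1`. Indeed `n ≡ 1 (mod 8)` gives
`(-1/n) = (2/n) = 1`, and for the odd part `c₀` of `c = 2ᵛ c₀`, `n ≡ 1 (mod 4c₀)` gives
`(c₀/n) = (c₀/1) = 1` by the periodicity of the Jacobi symbol in its lower entry. [folklore] -/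
theorem jacobiSym_neg_eq_one_of_dvd {c n : ℕ} (hc8 : 8 ∣ c) (hn : (c : ℤ) ∣ (n : ℤ) - 1) :
    J(-(c : ℤ) | n) = 1 := by
  rcases Nat.eq_zero_or_pos c with rfl | hc0
  · have h1 : n = 1 := by
      rw [Nat.cast_zero, zero_dvd_iff, sub_eq_zero] at hn
      exact_mod_cast hn
    rw [h1, jacobiSym.one_right]
  obtain ⟨v, c₀, hc₀, rfl⟩ := Nat.exists_eq_two_pow_mul_odd hc0.ne'
  -- `n ≡ 1 (mod 8)`
  have h8 : (8 : ℤ) ∣ (n : ℤ) - 1 := dvd_trans (by exact_mod_cast hc8) hn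
  obtain ⟨q, hq⟩ := h8
  have hn8 : n % 8 = 1 := by omega
  have hnodd : Odd n := Nat.odd_iff.mpr (by omega)
  -- `v ≥ 3`
  have hv : 3 ≤ v := by
    have hcop : Nat.Coprime (2 ^ 3) c₀ :=
      Nat.Coprime.pow_left 3 ((Nat.Prime.coprime_iff_not_dvd Nat.prime_two).mpr hc₀.not_two_dvd_nat)
    have h83 : 2 ^ 3 ∣ 2 ^ v := hcop.dvd_of_dvd_mul_right (by simpa using hc8)
    exact (Nat.pow_dvd_pow_iff_le_right (by norm_num)).mp h83
  -- `n ≡ 1 (mod 4 c₀)`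
  have h4c : ((4 * c₀ : ℕ) : ℤ) ∣ (n : ℤ) - 1 := by
    refine dvd_trans ?_ hn
    have h42 : (4 : ℕ) ∣ 2 ^ v := by
      rw [show (4 : ℕ) = 2 ^ 2 by norm_num]
      exact Nat.pow_dvd_pow 2 (by omega)
    exact_mod_cast Nat.mul_dvd_mul_right h42 c₀
  obtain ⟨r, hr⟩ := h4c
  have hc₀pos : 0 < c₀ := hc₀.pos
  have hr0 : 0 ≤ r := by
    by_contra hneg
    push Not at hneg
    have : ((4 * c₀ : ℕ) : ℤ) * r ≤ ((4 * c₀ : ℕ) : ℤ) * (-1) :=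
      Int.mul_le_mul_of_nonneg_left (by omega) (by positivity)
    omega
  have hnmod : n % (4 * c₀) = 1 := by
    have hn' : n = 1 + (4 * c₀) * r.toNat := by
      have := Int.toNat_of_nonneg hr0
      zify
      rw [this]
      push_cast at hr
      linarith
    rw [hn', Nat.add_mul_mod_self_left, Nat.mod_eq_of_lt (by omega)]
  -- assemble
  rw [jacobiSym.neg _ hnodd, ZMod.χ₄_nat_one_mod_four (by omega), one_mul]
  push_cast
  rw [jacobiSym.mul_left, jacobiSym.pow_left, jacobiSym.at_two hnodd, ZMod.χ₈_nat_eq_if_mod_eight,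
    if_neg (by omega), if_pos (Or.inl hn8), one_pow, one_mul, jacobiSym.mod_right' c₀ hnodd, hnmod]
  exact_mod_cast jacobiSym.one_right (c₀ : ℤ)

end Reciprocity

/-! ## Part 3. The partners `b ↦ -(Nb)⁻¹`, the cofactors in `Γ₀(N)` and the point identities -/

section FrickeB

variable {N : ℕ} [NeZero N] {p : ℕ} [Fact p.Prime]

/-! ### Units modulo `p²`: `b ↦ b' = -(Nb)⁻¹` -/

omit [NeZero N] in
/-- `N` is a unit modulo `p²` when `p ∤ N`. [folklore] -/
theorem isUnit_N_sq (hpN : ¬ p ∣ N) : IsUnit ((N : ℕ) : ZMod (p ^ 2)) :=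
  (ZMod.isUnit_iff_coprime N (p ^ 2)).mpr (coprime_N_sq (Fact.out : p.Prime) hpN)

omit [NeZero N] in
/-- `N ≢ 0 (mod p)` when `p ∤ N`. [folklore] -/
theorem natCast_N_ne_zero_zmodp (hpN : ¬ p ∣ N) : ((N : ℕ) : ZMod p) ≠ 0 := by
  rwa [ne_eq, ZMod.natCast_eq_zero_iff]

variable (N) in
/-- **The partner `b' = -(Nb)⁻¹ (mod p²)`** of a unit `b` modulo `p²`: `N b b' ≡ -1`. [folklore] -/
def unitPartner (b : ZMod (p ^ 2)) : ZMod (p ^ 2) := -(((N : ℕ) : ZMod (p ^ 2)) * b)⁻¹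

omit [NeZero N] in
/-- `N b b' = -1` for a unit `b`. [folklore] -/
theorem N_mul_mul_unitPartner (hpN : ¬ p ∣ N) {b : ZMod (p ^ 2)} (hb : IsUnit b) :
    ((N : ℕ) : ZMod (p ^ 2)) * b * unitPartner N b = -1 := by
  rw [unitPartner, mul_neg, ZMod.mul_inv_of_unit _ ((isUnit_N_sq hpN).mul hb)]

omit [NeZero N] in
/-- `b'` is a unit. [folklore] -/
theorem isUnit_unitPartner (hpN : ¬ p ∣ N) {b : ZMod (p ^ 2)} (hb : IsUnit b) :
    IsUnit (unitPartner N b) := by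
  obtain ⟨u, hu⟩ := (isUnit_N_sq hpN).mul hb
  rw [unitPartner, ← hu, ZMod.inv_coe_unit]
  exact (Units.isUnit _).neg

omit [NeZero N] in
/-- `(b')' = b`: the partner map is an involution on the units. [folklore] -/
theorem unitPartner_unitPartner (hpN : ¬ p ∣ N) {b : ZMod (p ^ 2)} (hb : IsUnit b) :
    unitPartner N (unitPartner N b) = b := by
  have h1 := N_mul_mul_unitPartner hpN (isUnit_unitPartner hpN hb)
  have h2 : ((N : ℕ) : ZMod (p ^ 2)) * unitPartner N b * b = -1 := by
    rw [mul_assoc, mul_comm (unitPartner N b), ← mul_assoc]; exact N_mul_mul_unitPartner hpN hb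
  exact ((isUnit_N_sq hpN).mul (isUnit_unitPartner hpN hb)).mul_left_cancel (h1.trans h2.symm)

omit [NeZero N] in
/-- `p² ∣ 1 + N b b'` (with the representatives `b.val, b'.val ∈ [0, p²)`). [folklore] -/
theorem sq_dvd_one_add_N_mul (hpN : ¬ p ∣ N) {b : ZMod (p ^ 2)} (hb : IsUnit b) :
    ((p : ℤ) ^ 2) ∣ 1 + (N : ℤ) * (b.val : ℤ) * ((unitPartner N b).val : ℤ) := by
  haveI : NeZero (p ^ 2) := ⟨pow_ne_zero 2 (Fact.out : p.Prime).ne_zero⟩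
  have h := N_mul_mul_unitPartner hpN hb
  have h0 : (((1 + (N : ℤ) * (b.val : ℤ) * ((unitPartner N b).val : ℤ) : ℤ)) : ZMod (p ^ 2)) = 0 := by
    push_cast
    rw [ZMod.natCast_zmod_val, ZMod.natCast_zmod_val]
    linear_combination h
  have := (ZMod.intCast_zmod_eq_zero_iff_dvd _ (p ^ 2)).mp h0
  exact_mod_cast this

/-- **`D_b = (1 + N b b')/p²`**, the lower-right entry of the cofactor of a unit `b`. [folklore] -/
def frickeDU (N : ℕ) (b : ZMod (p ^ 2)) : ℤ :=
  (1 + (N : ℤ) * (b.val : ℤ) * ((unitPartner N b).val : ℤ)) / (p : ℤ) ^ 2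

omit [NeZero N] in
/-- `D_b p² = 1 + N b b'`. [folklore] -/
theorem frickeDU_mul_sq (hpN : ¬ p ∣ N) {b : ZMod (p ^ 2)} (hb : IsUnit b) :
    frickeDU N b * (p : ℤ) ^ 2 = 1 + (N : ℤ) * (b.val : ℤ) * ((unitPartner N b).val : ℤ) :=
  Int.ediv_mul_cancel (sq_dvd_one_add_N_mul hpN hb)

variable (N) in
/-- **The cofactor `γ_b = (p², -b'; -Nb, D_b) ∈ Γ₀(N)`** of a unit `b` modulo `p²`:
`W_N ((z + b)/p²) = γ_b ((W_N z + b')/p²)`. [folklore] -/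
def frickeGammaU (hpN : ¬ p ∣ N) (b : ZMod (p ^ 2)) (hb : IsUnit b) : SL(2, ℤ) :=
  ⟨!![(p : ℤ) ^ 2, -(((unitPartner N b).val : ℕ) : ℤ); -((N : ℤ) * (b.val : ℤ)), frickeDU N b], by
    rw [Matrix.det_fin_two_of]
    linear_combination frickeDU_mul_sq hpN hb⟩

omit [NeZero N] in
/-- Entries of `γ_b`. [folklore] -/
theorem frickeGammaU_apply (hpN : ¬ p ∣ N) (b : ZMod (p ^ 2)) (hb : IsUnit b) :
    (frickeGammaU N hpN b hb) 0 0 = (p : ℤ) ^ 2 ∧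
    (frickeGammaU N hpN b hb) 0 1 = -(((unitPartner N b).val : ℕ) : ℤ) ∧
    (frickeGammaU N hpN b hb) 1 0 = -((N : ℤ) * (b.val : ℤ)) ∧
    (frickeGammaU N hpN b hb) 1 1 = frickeDU N b :=
  ⟨rfl, rfl, rfl, rfl⟩

omit [NeZero N] in
/-- `γ_b ∈ Γ₀(N)`. [folklore] -/
theorem frickeGammaU_mem (hpN : ¬ p ∣ N) (b : ZMod (p ^ 2)) (hb : IsUnit b) :
    frickeGammaU N hpN b hb ∈ Gamma0 N := by
  rw [Gamma0_mem, (frickeGammaU_apply hpN b hb).2.2.1]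
  push_cast
  rw [ZMod.natCast_self, zero_mul, neg_zero]

/-! ### Residues modulo `p`: `s ↦ s' = -(Ns)⁻¹` and the non-units `ps` modulo `p²` -/

variable (N) in
/-- **The partner `s' = -(Ns)⁻¹ (mod p)`** (`0' = 0`). [folklore] -/
def pPartner (s : ZMod p) : ZMod p := -(((N : ℕ) : ZMod p) * s)⁻¹

omit [NeZero N] in
/-- `0' = 0`. [folklore] -/
theorem pPartner_zero : pPartner N (0 : ZMod p) = 0 := by
  simp [pPartner]

omit [NeZero N] in
/-- `(s')' = s`: the partner map is an involution of `ℤ/p`. [folklore] -/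
theorem pPartner_pPartner (hpN : ¬ p ∣ N) (s : ZMod p) : pPartner N (pPartner N s) = s := by
  have hN := natCast_N_ne_zero_zmodp hpN
  unfold pPartner
  rw [mul_neg, inv_neg, neg_neg, mul_inv, inv_inv, inv_mul_cancel_left₀ hN]

omit [NeZero N] in
/-- `s' ≠ 0` for `s ≠ 0`. [folklore] -/
theorem pPartner_ne_zero (hpN : ¬ p ∣ N) {s : ZMod p} (hs : s ≠ 0) : pPartner N s ≠ 0 := by
  intro h
  have := pPartner_pPartner hpN s
  rw [h, pPartner_zero] at this
  exact hs this.symm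

omit [NeZero N] in
/-- `N s s' = -1` for `s ≠ 0`. [folklore] -/
theorem N_mul_mul_pPartner (hpN : ¬ p ∣ N) {s : ZMod p} (hs : s ≠ 0) :
    ((N : ℕ) : ZMod p) * s * pPartner N s = -1 := by
  rw [pPartner, mul_neg, mul_inv_cancel₀ (mul_ne_zero (natCast_N_ne_zero_zmodp hpN) hs)]

omit [NeZero N] in
/-- `p ∣ 1 + N s s'` (representatives in `[0, p)`). [folklore] -/
theorem p_dvd_one_add_N_mul (hpN : ¬ p ∣ N) {s : ZMod p} (hs : s ≠ 0) :
    (p : ℤ) ∣ 1 + (N : ℤ) * (s.val : ℤ) * ((pPartner N s).val : ℤ) := by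
  have h := N_mul_mul_pPartner hpN hs
  have h0 : (((1 + (N : ℤ) * (s.val : ℤ) * ((pPartner N s).val : ℤ) : ℤ)) : ZMod p) = 0 := by
    push_cast
    rw [ZMod.natCast_zmod_val, ZMod.natCast_zmod_val]
    linear_combination h
  exact (ZMod.intCast_zmod_eq_zero_iff_dvd _ p).mp h0

/-- **`D_s = (1 + N s s')/p`**, the lower-right entry of the cofactor of `s ≠ 0`. [folklore] -/
def frickeDP (N : ℕ) (s : ZMod p) : ℤ :=
  (1 + (N : ℤ) * (s.val : ℤ) * ((pPartner N s).val : ℤ)) / (p : ℤ)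

omit [NeZero N] in
/-- `D_s p = 1 + N s s'`. [folklore] -/
theorem frickeDP_mul_p (hpN : ¬ p ∣ N) {s : ZMod p} (hs : s ≠ 0) :
    frickeDP N s * (p : ℤ) = 1 + (N : ℤ) * (s.val : ℤ) * ((pPartner N s).val : ℤ) :=
  Int.ediv_mul_cancel (p_dvd_one_add_N_mul hpN hs)

variable (N) in
/-- **The cofactor `δ_s = (p, -s'; -Ns, D_s) ∈ Γ₀(N)`** of `s ≢ 0 (mod p)`:
`W_N ((z + ps)/p²) = δ_s (W_N z + s'/p)` and `W_N (z + s/p) = δ_s ((W_N z + p s')/p²)`. [folklore] -/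
def frickeGammaP (hpN : ¬ p ∣ N) (s : ZMod p) (hs : s ≠ 0) : SL(2, ℤ) :=
  ⟨!![(p : ℤ), -(((pPartner N s).val : ℕ) : ℤ); -((N : ℤ) * (s.val : ℤ)), frickeDP N s], by
    rw [Matrix.det_fin_two_of]
    linear_combination frickeDP_mul_p hpN hs⟩

omit [NeZero N] in
/-- Entries of `δ_s`. [folklore] -/
theorem frickeGammaP_apply (hpN : ¬ p ∣ N) (s : ZMod p) (hs : s ≠ 0) :
    (frickeGammaP N hpN s hs) 0 0 = (p : ℤ) ∧
    (frickeGammaP N hpN s hs) 0 1 = -(((pPartner N s).val : ℕ) : ℤ) ∧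
    (frickeGammaP N hpN s hs) 1 0 = -((N : ℤ) * (s.val : ℤ)) ∧
    (frickeGammaP N hpN s hs) 1 1 = frickeDP N s :=
  ⟨rfl, rfl, rfl, rfl⟩

omit [NeZero N] in
/-- `δ_s ∈ Γ₀(N)`. [folklore] -/
theorem frickeGammaP_mem (hpN : ¬ p ∣ N) (s : ZMod p) (hs : s ≠ 0) :
    frickeGammaP N hpN s hs ∈ Gamma0 N := by
  rw [Gamma0_mem, (frickeGammaP_apply hpN s hs).2.2.1]
  push_cast
  rw [ZMod.natCast_self, zero_mul, neg_zero]

variable (p) in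
/-- The non-unit `p s (mod p²)` attached to `s (mod p)`. [folklore] -/
def bOfS (s : ZMod p) : ZMod (p ^ 2) := ((p * s.val : ℕ) : ZMod (p ^ 2))

/-- `(p s).val = p · s.val`. [folklore] -/
theorem val_bOfS (s : ZMod p) : (bOfS p s).val = p * s.val := by
  rw [bOfS, ZMod.val_natCast, Nat.mod_eq_of_lt]
  have h1 := ZMod.val_lt s
  have h2 := (Fact.out : p.Prime).pos
  rw [sq]
  nlinarith

/-- `p · 0 = 0`. [folklore] -/
theorem bOfS_zero : bOfS p (0 : ZMod p) = 0 := by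
  simp [bOfS]

/-! ### The points: `W_N` conjugates the pieces of `T(p²)` -/

/-- `W_N (p² z) = (W_N z)/p²`. [folklore] -/
theorem frickePoint_mulPSq (z : ℍ) : frickePoint N (mulPSq p z) = divPSq p (frickePoint N z) := by
  apply UpperHalfPlane.ext
  rw [coe_frickePoint, coe_mulPSq, coe_divPSq, coe_frickePoint]
  have hz := UpperHalfPlane.ne_zero z
  have hN := natCast_N_ne_zero (N := N)
  have hp := natCast_p_ne_zero (p := p)
  field_simp

/-- `W_N (z/p²) = p² (W_N z)`. [folklore] -/
theorem frickePoint_divPSq (z : ℍ) : frickePoint N (divPSq p z) = mulPSq p (frickePoint N z) := by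
  apply UpperHalfPlane.ext
  rw [coe_frickePoint, coe_mulPSq, coe_divPSq, coe_frickePoint]
  have hz := UpperHalfPlane.ne_zero z
  have hN := natCast_N_ne_zero (N := N)
  have hp := natCast_p_ne_zero (p := p)
  field_simp

omit [NeZero N] in
/-- `(z + 0)/p² = z/p²`. [folklore] -/
theorem transDiv_zero (z : ℍ) : transDiv p (0 : ZMod (p ^ 2)) z = divPSq p z := by
  apply UpperHalfPlane.ext
  rw [coe_transDiv, coe_divPSq, ZMod.val_zero, Nat.cast_zero, add_zero]

/-- **Units**: `W_N ((z + b)/p²) = γ_b · ((W_N z + b')/p²)`. [folklore] -/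
theorem frickePoint_transDiv_unit (hpN : ¬ p ∣ N) {b : ZMod (p ^ 2)} (hb : IsUnit b) (z : ℍ) :
    frickePoint N (transDiv p b z) =
      frickeGammaU N hpN b hb • transDiv p (unitPartner N b) (frickePoint N z) := by
  obtain ⟨h00, h01, h10, h11⟩ := frickeGammaU_apply hpN b hb
  have hD := frickeDU_mul_sq hpN hb
  have hz := UpperHalfPlane.ne_zero z
  have hN := natCast_N_ne_zero (N := N)
  have hp := natCast_p_ne_zero (p := p)
  have hzb : (z : ℂ) + (b.val : ℂ) ≠ 0 := by
    have := UpperHalfPlane.ne_zero (((b.val : ℕ) : ℝ) +ᵥ z)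
    rw [coe_vadd] at this
    push_cast at this
    rwa [add_comm] at this
  have hDc : ((frickeDU N b : ℤ) : ℂ) =
      (1 + (N : ℂ) * (b.val : ℂ) * ((unitPartner N b).val : ℂ)) / (p : ℂ) ^ 2 := by
    rw [eq_div_iff (pow_ne_zero 2 hp)]
    exact_mod_cast hD
  apply UpperHalfPlane.ext
  rw [coe_frickePoint, coe_transDiv, coe_specialLinearGroup_apply, coe_transDiv, coe_frickePoint]
  simp only [h00, h01, h10, h11, eq_intCast]
  push_cast
  rw [hDc]
  exact fricke_coord_unit _ _ _ _ _ hz hN hp hzb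

/-- **Multiples of `p`**: `W_N ((z + ps)/p²) = δ_s · (W_N z + s'/p)`. [folklore] -/
theorem frickePoint_transDiv_bOfS (hpN : ¬ p ∣ N) {s : ZMod p} (hs : s ≠ 0) (z : ℍ) :
    frickePoint N (transDiv p (bOfS p s) z) =
      frickeGammaP N hpN s hs •
        (((((pPartner N s).val : ℕ) : ℝ) / (p : ℝ) : ℝ) +ᵥ frickePoint N z) := by
  obtain ⟨h00, h01, h10, h11⟩ := frickeGammaP_apply hpN s hs
  have hD := frickeDP_mul_p hpN hs
  have hz := UpperHalfPlane.ne_zero z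
  have hN := natCast_N_ne_zero (N := N)
  have hp := natCast_p_ne_zero (p := p)
  have hzb : (p : ℂ) * (s.val : ℂ) + (z : ℂ) ≠ 0 := by
    have := UpperHalfPlane.ne_zero ((((bOfS p s).val : ℕ) : ℝ) +ᵥ z)
    rw [coe_vadd, val_bOfS] at this
    push_cast at this
    exact this
  have hDc : ((frickeDP N s : ℤ) : ℂ) =
      (1 + (N : ℂ) * (s.val : ℂ) * ((pPartner N s).val : ℂ)) / (p : ℂ) := by
    rw [eq_div_iff hp]
    exact_mod_cast hD
  apply UpperHalfPlane.ext
  rw [coe_frickePoint, coe_transDiv, coe_specialLinearGroup_apply, coe_vadd, coe_frickePoint,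
    val_bOfS]
  simp only [h00, h01, h10, h11, eq_intCast]
  push_cast
  rw [hDc]
  exact fricke_coord_bOfS _ _ _ _ _ hz hN hp hzb

/-- **Translates**: `W_N (z + t/p) = δ_t · ((W_N z + p t')/p²)`. [folklore] -/
theorem frickePoint_vadd (hpN : ¬ p ∣ N) {t : ZMod p} (ht : t ≠ 0) (z : ℍ) :
    frickePoint N ((((t.val : ℕ) : ℝ) / (p : ℝ) : ℝ) +ᵥ z) =
      frickeGammaP N hpN t ht • transDiv p (bOfS p (pPartner N t)) (frickePoint N z) := by
  obtain ⟨h00, h01, h10, h11⟩ := frickeGammaP_apply hpN t ht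
  have hD := frickeDP_mul_p hpN ht
  have hz := UpperHalfPlane.ne_zero z
  have hN := natCast_N_ne_zero (N := N)
  have hp := natCast_p_ne_zero (p := p)
  have hzb : (p : ℂ) * (z : ℂ) + (t.val : ℂ) ≠ 0 := by
    have := UpperHalfPlane.ne_zero ((((t.val : ℕ) : ℝ) / (p : ℝ) : ℝ) +ᵥ z)
    rw [coe_vadd] at this
    push_cast at this
    intro h
    apply this
    field_simp
    linear_combination h
  have hDc : ((frickeDP N t : ℤ) : ℂ) =
      (1 + (N : ℂ) * (t.val : ℂ) * ((pPartner N t).val : ℂ)) / (p : ℂ) := by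
    rw [eq_div_iff hp]
    exact_mod_cast hD
  apply UpperHalfPlane.ext
  rw [coe_frickePoint, coe_vadd, coe_specialLinearGroup_apply, coe_transDiv, coe_frickePoint,
    val_bOfS]
  simp only [h00, h01, h10, h11, eq_intCast]
  push_cast
  rw [hDc]
  exact fricke_coord_vadd _ _ _ _ _ hz hN hp hzb

end FrickeB

/-! ## Part 4. The automorphy factors of the cofactors -/

section FrickeC

variable {k N : ℕ} [NeZero N] {χ : DirichletCharacter ℂ N} {p : ℕ} [Fact p.Prime]

omit [NeZero N] [Fact p.Prime] in
/-- `p ≠ 2` when `8 ∣ N` and `p ∤ N`. [folklore] -/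
theorem p_ne_two (hN : 8 ∣ N) (hpN : ¬ p ∣ N) : p ≠ 2 :=
  fun h ↦ hpN (h ▸ dvd_trans ⟨4, by norm_num⟩ hN)

omit [NeZero N] in
/-- `p` is odd. [folklore] -/
theorem p_odd (hN : 8 ∣ N) (hpN : ¬ p ∣ N) : Odd p :=
  (Fact.out : p.Prime).odd_of_ne_two (p_ne_two hN hpN)

omit [NeZero N] in
/-- `p² ≡ 1 (mod 8)`. [folklore] -/
theorem sq_emod_eight (hN : 8 ∣ N) (hpN : ¬ p ∣ N) : ((p : ℤ) ^ 2) % 8 = 1 := by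
  obtain ⟨r, hr⟩ := p_odd hN hpN
  rw [hr]
  push_cast
  have : (2 * (r : ℤ) + 1) ^ 2 = 4 * ((r : ℤ) * (r + 1)) + 1 := by ring
  rw [this]
  obtain ⟨m, hm⟩ := Int.even_mul_succ_self (r : ℤ)
  rw [hm]
  omega

omit [NeZero N] in
/-- `χ(p) ≠ 0` for `p ∤ N`. [folklore] -/
theorem chi_p_ne_zero' (hpN : ¬ p ∣ N) : χ (p : ZMod N) ≠ 0 :=
  (((ZMod.isUnit_prime_iff_not_dvd (Fact.out : p.Prime)).mpr hpN).map χ).ne_zero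

omit [NeZero N] [Fact p.Prime] in
/-- `x^k = x` for `x² = 1` and `k` odd. [folklore] -/
theorem pow_eq_self_of_sq_eq_one {x : ℂ} (hx : x ^ 2 = 1) (hk : Odd k) : x ^ k = x := by
  obtain ⟨m, rfl⟩ := hk
  rw [pow_succ, pow_mul, hx, one_pow, one_mul]

omit [NeZero N] in
/-- `N` and `p` are coprime. [folklore] -/
theorem coprime_N_p (hpN : ¬ p ∣ N) : Nat.Coprime N p :=
  Nat.coprime_comm.mp (((Fact.out : p.Prime).coprime_iff_not_dvd).mpr hpN)

/-! ### The unit cofactor `γ_b`: `χ(D_b) = χ(p)⁻²`, `ε_{D_b} = 1`, `(-Nb / D_b) = 1` -/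

omit [NeZero N] in
/-- `χ(D_b) = χ(p)⁻²` (`D_b p² ≡ 1 (mod N)`). [folklore] -/
theorem chi_frickeDU (hpN : ¬ p ∣ N) {b : ZMod (p ^ 2)} (hb : IsUnit b) :
    χ ((frickeDU N b : ℤ) : ZMod N) = (χ (p : ZMod N))⁻¹ ^ 2 := by
  have hD := frickeDU_mul_sq hpN hb
  have h1 : ((frickeDU N b : ℤ) : ZMod N) * (p : ZMod N) ^ 2 = 1 := by
    have := congrArg (Int.cast : ℤ → ZMod N) hD
    push_cast at this
    rw [ZMod.natCast_self, zero_mul, zero_mul, add_zero] at this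
    exact this
  have h2 : χ ((frickeDU N b : ℤ) : ZMod N) * χ (p : ZMod N) ^ 2 = 1 := by
    rw [← map_pow, ← map_mul, h1, map_one]
  rw [inv_pow]
  exact eq_inv_of_mul_eq_one_left h2

omit [NeZero N] in
/-- `D_b ≡ 1 (mod 8)` (`D_b p² ≡ 1`, `p² ≡ 1 (mod 8)`), so `ε_{D_b} = 1`. [folklore] -/
theorem thetaEps_frickeDU (hN : 8 ∣ N) (hpN : ¬ p ∣ N) {b : ZMod (p ^ 2)} (hb : IsUnit b) :
    thetaEps (frickeDU N b) = 1 := by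
  have hD := frickeDU_mul_sq hpN hb
  have h8 := sq_emod_eight hN hpN
  obtain ⟨m, hm⟩ := hN
  have hP : (p : ℤ) ^ 2 ≡ 1 [ZMOD 8] := h8
  have hDP : frickeDU N b * (p : ℤ) ^ 2 ≡ 1 [ZMOD 8] := by
    refine (Int.modEq_iff_dvd.mpr ?_).symm
    rw [hD]
    refine ⟨(m : ℤ) * b.val * (unitPartner N b).val, ?_⟩
    rw [hm]
    push_cast
    ring
  have h1 : frickeDU N b * 1 ≡ 1 [ZMOD 8] := (hDP.symm.trans (Int.ModEq.mul_left _ hP)).symm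
  rw [mul_one] at h1
  have h2 : frickeDU N b % 8 = 1 := h1
  unfold thetaEps
  rw [if_neg (by omega)]

omit [NeZero N] in
/-- `D_b > 0`. [folklore] -/
theorem frickeDU_pos (hpN : ¬ p ∣ N) {b : ZMod (p ^ 2)} (hb : IsUnit b) : 0 < frickeDU N b := by
  have hD := frickeDU_mul_sq hpN hb
  have hpos : 0 < frickeDU N b * (p : ℤ) ^ 2 := by rw [hD]; positivity
  by_contra h
  push Not at h
  nlinarith [sq_nonneg (p : ℤ)]

omit [NeZero N] in
/-- `gcd(N b, p) = 1` for a unit `b` modulo `p²`. [folklore] -/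
theorem coprime_N_mul_val (hpN : ¬ p ∣ N) {b : ZMod (p ^ 2)} (hb : IsUnit b) :
    Nat.Coprime (N * b.val) p := by
  haveI : NeZero (p ^ 2) := ⟨pow_ne_zero 2 (Fact.out : p.Prime).ne_zero⟩
  refine Nat.Coprime.mul_left (coprime_N_p hpN) ?_
  have h : IsUnit ((b.val : ℕ) : ZMod (p ^ 2)) := by rwa [ZMod.natCast_zmod_val]
  exact Nat.Coprime.coprime_dvd_right (dvd_pow_self p two_ne_zero)
    ((ZMod.isUnit_iff_coprime _ _).mp h)

omit [NeZero N] in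
/-- **`(-Nb / D_b) = 1`**: `(-Nb / D_b)(-Nb / p²) = (-Nb / 1 + N b b') = 1` (`8 ∣ Nb`,
`jacobiSym_neg_eq_one_of_dvd`) and `(-Nb / p²) = (-Nb/p)² = 1`. [folklore] -/
theorem shimuraSymbol_frickeDU (hN : 8 ∣ N) (hpN : ¬ p ∣ N) {b : ZMod (p ^ 2)}
    (hb : IsUnit b) : shimuraSymbol (-((N : ℤ) * (b.val : ℤ))) (frickeDU N b) = 1 := by
  have hp : p.Prime := Fact.out
  have hD := frickeDU_mul_sq hpN hb
  have hDpos := frickeDU_pos hpN hb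
  rw [shimuraSymbol_of_pos_right _ hDpos]
  set n := (frickeDU N b).natAbs with hn
  have hncast : (n : ℤ) = frickeDU N b := Int.natAbs_of_nonneg hDpos.le
  have hn0 : n ≠ 0 := by omega
  have hp0 : p ^ 2 ≠ 0 := pow_ne_zero 2 hp.ne_zero
  have hcast : -((N : ℤ) * (b.val : ℤ)) = -((N * b.val : ℕ) : ℤ) := by push_cast; ring
  -- `(-Nb / n p²) = 1`
  have hbig : J(-((N : ℤ) * (b.val : ℤ)) | n * p ^ 2) = 1 := by
    rw [hcast]
    apply jacobiSym_neg_eq_one_of_dvd (dvd_mul_of_dvd_left hN _)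
    push_cast
    rw [hncast, hD]
    exact ⟨(unitPartner N b).val, by ring⟩
  -- `(-Nb / p²) = 1`
  have hsq : J(-((N : ℤ) * (b.val : ℤ)) | p ^ 2) = 1 := by
    rw [jacobiSym.pow_right]
    apply jacobiSym.sq_one
    rw [hcast, Int.neg_gcd, Int.gcd_natCast_natCast]
    exact coprime_N_mul_val hpN hb
  rwa [jacobiSym.mul_right' _ hn0 hp0, hsq, mul_one] at hbig

omit [NeZero N] in
/-- **The automorphy factor of `γ_b`** at any point: `χ(D_b) j(γ_b, v)^k = χ(p)⁻² √(-Nb v + D_b)^k`.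
[folklore] -/
theorem autFactor_frickeGammaU (hN : 8 ∣ N) (hpN : ¬ p ∣ N) {b : ZMod (p ^ 2)} (hb : IsUnit b)
    (v : ℍ) :
    autFactor k N χ (frickeGammaU N hpN b hb) v =
      (χ (p : ZMod N))⁻¹ ^ 2 *
        Complex.sqrt ((-((N : ℤ) * (b.val : ℤ)) : ℂ) * v + (frickeDU N b : ℂ)) ^ k := by
  obtain ⟨-, -, h10, h11⟩ := frickeGammaU_apply hpN b hb
  unfold autFactor thetaFactor
  rw [h10, h11, chi_frickeDU hpN hb, thetaEps_frickeDU hN hpN hb, shimuraSymbol_frickeDU hN hpN hb]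
  push_cast
  ring

/-! ### The cofactor `δ_s`: `χ(D_s) = χ(p)⁻¹`, `ε_{D_s} = ε_p`, `(-Ns / D_s) = (-Ns / p) = (s'/p)` -/

omit [NeZero N] in
/-- `χ(D_s) = χ(p)⁻¹` (`D_s p ≡ 1 (mod N)`). [folklore] -/
theorem chi_frickeDP (hpN : ¬ p ∣ N) {s : ZMod p} (hs : s ≠ 0) :
    χ ((frickeDP N s : ℤ) : ZMod N) = (χ (p : ZMod N))⁻¹ := by
  have hD := frickeDP_mul_p hpN hs
  have h1 : ((frickeDP N s : ℤ) : ZMod N) * (p : ZMod N) = 1 := by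
    have := congrArg (Int.cast : ℤ → ZMod N) hD
    push_cast at this
    rw [ZMod.natCast_self, zero_mul, zero_mul, add_zero] at this
    exact this
  have h2 : χ ((frickeDP N s : ℤ) : ZMod N) * χ (p : ZMod N) = 1 := by
    rw [← map_mul, h1, map_one]
  exact eq_inv_of_mul_eq_one_left h2

omit [NeZero N] in
/-- `D_s ≡ p (mod 8)` (`D_s p ≡ 1 ≡ p²`), so `ε_{D_s} = ε_p`. [folklore] -/
theorem thetaEps_frickeDP (hN : 8 ∣ N) (hpN : ¬ p ∣ N) {s : ZMod p} (hs : s ≠ 0) :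
    thetaEps (frickeDP N s) = thetaEps p := by
  have hD := frickeDP_mul_p hpN hs
  have h8 := sq_emod_eight hN hpN
  obtain ⟨m, hm⟩ := hN
  have hP : (p : ℤ) ^ 2 ≡ 1 [ZMOD 8] := h8
  have hDP : frickeDP N s * (p : ℤ) ≡ 1 [ZMOD 8] := by
    refine (Int.modEq_iff_dvd.mpr ?_).symm
    rw [hD]
    refine ⟨(m : ℤ) * s.val * (pPartner N s).val, ?_⟩
    rw [hm]
    push_cast
    ring
  -- `D ≡ D p² = (D p) p ≡ p`
  have h1 : frickeDP N s * 1 ≡ 1 * (p : ℤ) [ZMOD 8] := by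
    have h3 : frickeDP N s * (p : ℤ) ^ 2 ≡ 1 * (p : ℤ) [ZMOD 8] := by
      rw [sq, ← mul_assoc]; exact Int.ModEq.mul_right _ hDP
    exact (Int.ModEq.mul_left _ hP).symm.trans h3
  rw [mul_one, one_mul] at h1
  have h2 : frickeDP N s % 8 = (p : ℤ) % 8 := h1
  exact thetaEps_eq_of_emod_eq (by omega)

omit [NeZero N] in
/-- `D_s > 0`. [folklore] -/
theorem frickeDP_pos (hpN : ¬ p ∣ N) {s : ZMod p} (hs : s ≠ 0) : 0 < frickeDP N s := by
  have hD := frickeDP_mul_p hpN hs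
  have hpos : 0 < frickeDP N s * (p : ℤ) := by rw [hD]; positivity
  by_contra h
  push Not at h
  nlinarith [(Nat.cast_nonneg p : (0 : ℤ) ≤ p)]

omit [NeZero N] in
/-- `gcd(N s, p) = 1` for `s ≢ 0 (mod p)`. [folklore] -/
theorem coprime_N_mul_val_p (hpN : ¬ p ∣ N) {s : ZMod p} (hs : s ≠ 0) :
    Nat.Coprime (N * s.val) p := by
  refine Nat.Coprime.mul_left (coprime_N_p hpN) ?_
  have h : IsUnit ((s.val : ℕ) : ZMod p) := by
    rw [ZMod.natCast_zmod_val]; exact isUnit_iff_ne_zero.mpr hs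
  exact (ZMod.isUnit_iff_coprime _ _).mp h

omit [NeZero N] in
/-- `gcd(t, p) = 1` for `t ≢ 0 (mod p)` (`0 < t.val < p`). [folklore] -/
theorem gcd_val_eq_one {t : ZMod p} (ht : t ≠ 0) : ((t.val : ℕ) : ℤ).gcd p = 1 := by
  rw [Int.gcd_natCast_natCast]
  exact (Nat.coprime_of_lt_prime ((ZMod.val_ne_zero t).mpr ht) (ZMod.val_lt t)
    (Fact.out : p.Prime)).symm

omit [NeZero N] in
/-- **`(-Ns / D_s) = (-Ns / p)`**: `(-Ns / D_s)(-Ns / p) = (-Ns / 1 + N s s') = 1` and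
`(-Ns/p)² = 1`. [folklore] -/
theorem shimuraSymbol_frickeDP (hN : 8 ∣ N) (hpN : ¬ p ∣ N) {s : ZMod p} (hs : s ≠ 0) :
    shimuraSymbol (-((N : ℤ) * (s.val : ℤ))) (frickeDP N s) = J(-((N : ℤ) * (s.val : ℤ)) | p) := by
  have hp : p.Prime := Fact.out
  have hD := frickeDP_mul_p hpN hs
  have hDpos := frickeDP_pos hpN hs
  rw [shimuraSymbol_of_pos_right _ hDpos]
  set n := (frickeDP N s).natAbs with hn
  have hncast : (n : ℤ) = frickeDP N s := Int.natAbs_of_nonneg hDpos.le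
  have hn0 : n ≠ 0 := by omega
  have hcast : -((N : ℤ) * (s.val : ℤ)) = -((N * s.val : ℕ) : ℤ) := by push_cast; ring
  have hbig : J(-((N : ℤ) * (s.val : ℤ)) | n * p) = 1 := by
    rw [hcast]
    apply jacobiSym_neg_eq_one_of_dvd (dvd_mul_of_dvd_left hN _)
    push_cast
    rw [hncast, hD]
    exact ⟨(pPartner N s).val, by ring⟩
  have hsq : J(-((N : ℤ) * (s.val : ℤ)) | p) ^ 2 = 1 := by
    apply jacobiSym.sq_one
    rw [hcast, Int.neg_gcd, Int.gcd_natCast_natCast]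
    exact coprime_N_mul_val_p hpN hs
  rw [jacobiSym.mul_right' _ hn0 hp.ne_zero] at hbig
  calc J(-((N : ℤ) * (s.val : ℤ)) | n)
      = J(-((N : ℤ) * (s.val : ℤ)) | n) * J(-((N : ℤ) * (s.val : ℤ)) | p) ^ 2 := by
        rw [hsq, mul_one]
    _ = J(-((N : ℤ) * (s.val : ℤ)) | p) := by rw [sq, ← mul_assoc, hbig, one_mul]

omit [NeZero N] in
/-- **`(-Ns / p) = (s' / p)`** (`N s s' ≡ -1 (mod p)`). [folklore] -/
theorem jacobiSym_neg_N_mul (hN : 8 ∣ N) (hpN : ¬ p ∣ N) {s : ZMod p} (hs : s ≠ 0) :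
    J(-((N : ℤ) * (s.val : ℤ)) | p) = J(((pPartner N s).val : ℤ) | p) := by
  have hp : p.Prime := Fact.out
  have hodd := p_odd hN hpN
  -- `N s s' ≡ -1 (mod p)` as integers
  have hrel : ((N : ℤ) * (s.val : ℤ) * ((pPartner N s).val : ℤ)) % p = (-1 : ℤ) % p := by
    rw [← ZMod.intCast_eq_intCast_iff']
    push_cast
    rw [ZMod.natCast_zmod_val, ZMod.natCast_zmod_val]
    exact N_mul_mul_pPartner hpN hs
  have h1 : J((N : ℤ) * (s.val : ℤ) * ((pPartner N s).val : ℤ) | p) = J(-1 | p) :=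
    jacobiSym.mod_left' hrel
  rw [jacobiSym.mul_left, jacobiSym.at_neg_one hodd] at h1
  have h4 : (ZMod.χ₄ (p : ZMod 4) : ℤ) ^ 2 = 1 := by
    rw [← jacobiSym.at_neg_one hodd]
    exact jacobiSym.sq_one (by simp)
  have ht2 : J(((pPartner N s).val : ℤ) | p) ^ 2 = 1 :=
    jacobiSym.sq_one (gcd_val_eq_one (pPartner_ne_zero hpN hs))
  rw [jacobiSym.neg _ hodd]
  -- `χ₄(p) (Ns/p) = (s'/p)` from `(Ns/p)(s'/p) = χ₄(p)`, both symbols being `±1`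
  calc (ZMod.χ₄ (p : ZMod 4) : ℤ) * J((N : ℤ) * (s.val : ℤ) | p)
      = ZMod.χ₄ (p : ZMod 4) * J((N : ℤ) * (s.val : ℤ) | p) *
          J(((pPartner N s).val : ℤ) | p) ^ 2 := by rw [ht2, mul_one]
    _ = ZMod.χ₄ (p : ZMod 4) * (J((N : ℤ) * (s.val : ℤ) | p) * J(((pPartner N s).val : ℤ) | p)) *
          J(((pPartner N s).val : ℤ) | p) := by ring
    _ = J(((pPartner N s).val : ℤ) | p) := by rw [h1, ← sq, h4, one_mul]

omit [NeZero N] in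
/-- `(-Nt / p) = (-1/p) (N/p) (t/p)`. [folklore] -/
theorem jacobiSym_neg_N_mul_eq_prod (hN : 8 ∣ N) (hpN : ¬ p ∣ N) (t : ZMod p) :
    J(-((N : ℤ) * (t.val : ℤ)) | p) = J(-1 | p) * J((N : ℤ) | p) * J((t.val : ℤ) | p) := by
  rw [jacobiSym.neg _ (p_odd hN hpN), jacobiSym.at_neg_one (p_odd hN hpN), jacobiSym.mul_left,
    mul_assoc]

omit [NeZero N] in
/-- **The automorphy factor of `δ_s` (first form)**:
`χ(D_s) j(δ_s, v)^k = χ(p)⁻¹ (ε_p⁻¹ (s'/p) √(-Ns v + D_s))^k`. [folklore] -/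
theorem autFactor_frickeGammaP (hN : 8 ∣ N) (hpN : ¬ p ∣ N) {s : ZMod p} (hs : s ≠ 0) (v : ℍ) :
    autFactor k N χ (frickeGammaP N hpN s hs) v =
      (χ (p : ZMod N))⁻¹ * ((thetaEps p)⁻¹ * (J(((pPartner N s).val : ℤ) | p) : ℂ) *
        Complex.sqrt ((-((N : ℤ) * (s.val : ℤ)) : ℂ) * v + (frickeDP N s : ℂ))) ^ k := by
  obtain ⟨-, -, h10, h11⟩ := frickeGammaP_apply hpN s hs
  unfold autFactor thetaFactor
  rw [h10, h11, chi_frickeDP hpN hs, thetaEps_frickeDP hN hpN hs, shimuraSymbol_frickeDP hN hpN hs,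
    jacobiSym_neg_N_mul hN hpN hs]
  push_cast
  ring

omit [NeZero N] in
/-- **The automorphy factor of `δ_t` (second form)**:
`χ(D_t) j(δ_t, v)^k = χ(p)⁻¹ (ε_p⁻¹ (-1/p)(N/p)(t/p) √(-Nt v + D_t))^k`. [folklore] -/
theorem autFactor_frickeGammaP' (hN : 8 ∣ N) (hpN : ¬ p ∣ N) {t : ZMod p} (ht : t ≠ 0) (v : ℍ) :
    autFactor k N χ (frickeGammaP N hpN t ht) v =
      (χ (p : ZMod N))⁻¹ * ((thetaEps p)⁻¹ *
        ((J(-1 | p) : ℂ) * (J((N : ℤ) | p) : ℂ) * (J((t.val : ℤ) | p) : ℂ)) *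
        Complex.sqrt ((-((N : ℤ) * (t.val : ℤ)) : ℂ) * v + (frickeDP N t : ℂ))) ^ k := by
  obtain ⟨-, -, h10, h11⟩ := frickeGammaP_apply hpN t ht
  unfold autFactor thetaFactor
  rw [h10, h11, chi_frickeDP hpN ht, thetaEps_frickeDP hN hpN ht, shimuraSymbol_frickeDP hN hpN ht,
    jacobiSym_neg_N_mul_eq_prod hN hpN t]
  push_cast
  ring

end FrickeC

/-! ## Part 5. The five families of terms of `T(p²)(W f)` -/

section FrickeD

variable {k N : ℕ} [NeZero N] {χ : DirichletCharacter ℂ N} {p : ℕ} [Fact p.Prime]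

/-- **(i)** `(W f)(p² z) = p^{-k} (-iz)^{-k/2} f((W z)/p²)`. [folklore] -/
theorem frickeFun_mulPSq (f : ℍ → ℂ) (z : ℍ) :
    frickeFun N k f (mulPSq p z) =
      ((p : ℂ))⁻¹ ^ k * ((Complex.sqrt (-I * (z : ℂ)))⁻¹ ^ k * f (divPSq p (frickePoint N z))) := by
  unfold frickeFun
  rw [frickePoint_mulPSq, coe_mulPSq,
    show -I * ((p : ℂ) ^ 2 * (z : ℂ)) = (p : ℂ) ^ 2 * (-I * (z : ℂ)) by ring, csqrt_p_sq_mul,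
    mul_inv, mul_pow]
  ring

/-- **(ii)** `(W f)(z/p²) = p^{k} (-iz)^{-k/2} f(p² (W z))`. [folklore] -/
theorem frickeFun_divPSq (f : ℍ → ℂ) (z : ℍ) :
    frickeFun N k f (divPSq p z) =
      (p : ℂ) ^ k * ((Complex.sqrt (-I * (z : ℂ)))⁻¹ ^ k * f (mulPSq p (frickePoint N z))) := by
  have hp := natCast_p_ne_zero (p := p)
  have h : Complex.sqrt (-I * ((divPSq p z : ℍ) : ℂ)) = Complex.sqrt (-I * (z : ℂ)) / p := by
    rw [eq_div_iff hp, mul_comm, ← csqrt_p_sq_mul, coe_divPSq]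
    congr 1
    field_simp
  unfold frickeFun
  rw [frickePoint_divPSq, h, inv_div, div_eq_mul_inv, mul_pow]
  ring

/-- **(iii) Units**: `(W f)((z + b)/p²) = χ(p)⁻² (-iz)^{-k/2} f((W z + b')/p²)` for
`f` automorphic of weight `k/2`, level `N`, character `χ`. [folklore] -/
theorem frickeFun_transDiv_unit (hN : 8 ∣ N) (hpN : ¬ p ∣ N) {f : ℍ → ℂ}
    (hf : ∀ γ ∈ Gamma0 N, ∀ z : ℍ, f (γ • z) = autFactor k N χ γ z * f z)
    {b : ZMod (p ^ 2)} (hb : IsUnit b) (z : ℍ) :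
    frickeFun N k f (transDiv p b z) =
      (χ (p : ZMod N))⁻¹ ^ 2 * ((Complex.sqrt (-I * (z : ℂ)))⁻¹ ^ k *
        f (transDiv p (unitPartner N b) (frickePoint N z))) := by
  have hz := UpperHalfPlane.ne_zero z
  have hNc := natCast_N_ne_zero (N := N)
  have hp := natCast_p_ne_zero (p := p)
  have hD := frickeDU_mul_sq hpN hb
  have hDc : ((frickeDU N b : ℤ) : ℂ) =
      (1 + (N : ℂ) * (b.val : ℂ) * ((unitPartner N b).val : ℂ)) / (p : ℂ) ^ 2 := by
    rw [eq_div_iff (pow_ne_zero 2 hp)]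
    exact_mod_cast hD
  -- the radicand of `j(γ_b, v)` is `(-iw)/(-iz)`
  have hX : ((-((N : ℤ) * (b.val : ℤ)) : ℂ)) *
        ((transDiv p (unitPartner N b) (frickePoint N z) : ℍ) : ℂ) + (frickeDU N b : ℂ) =
      (-I * ((transDiv p b z : ℍ) : ℂ)) / (-I * (z : ℂ)) := by
    rw [coe_transDiv, coe_transDiv, coe_frickePoint, hDc]
    push_cast
    field_simp
    ring
  have hw0 := csqrt_neg_I_mul_ne_zero (transDiv p b z)
  unfold frickeFun
  rw [frickePoint_transDiv_unit hpN hb z, hf _ (frickeGammaU_mem hpN b hb),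
    autFactor_frickeGammaU hN hpN hb, hX,
    csqrt_div_of_re_pos (re_neg_I_mul_pos _) (re_neg_I_mul_pos z)]
  calc _ = ((Complex.sqrt (-I * ((transDiv p b z : ℍ) : ℂ)))⁻¹ *
        Complex.sqrt (-I * ((transDiv p b z : ℍ) : ℂ))) ^ k *
      ((χ (p : ZMod N))⁻¹ ^ 2 * ((Complex.sqrt (-I * (z : ℂ)))⁻¹ ^ k *
        f (transDiv p (unitPartner N b) (frickePoint N z)))) := by ring
    _ = _ := by rw [inv_mul_cancel₀ hw0, one_pow, one_mul]

/-- **(iv) Multiples of `p`**: `(W f)((z + ps)/p²) = χ(p)⁻¹ (ε_p⁻¹ √p)^k (s'/p) (-iz)^{-k/2} f(W z + s'/p)`.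
[folklore] -/
theorem frickeFun_transDiv_bOfS (hN : 8 ∣ N) (hpN : ¬ p ∣ N) (hk : Odd k) {f : ℍ → ℂ}
    (hf : ∀ γ ∈ Gamma0 N, ∀ z : ℍ, f (γ • z) = autFactor k N χ γ z * f z)
    {s : ZMod p} (hs : s ≠ 0) (z : ℍ) :
    frickeFun N k f (transDiv p (bOfS p s) z) =
      (χ (p : ZMod N))⁻¹ * ((thetaEps p)⁻¹ * (Real.sqrt p : ℂ)) ^ k *
        (J(((pPartner N s).val : ℤ) | p) : ℂ) *
        ((Complex.sqrt (-I * (z : ℂ)))⁻¹ ^ k *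
          f (((((pPartner N s).val : ℕ) : ℝ) / (p : ℝ) : ℝ) +ᵥ frickePoint N z)) := by
  have hz := UpperHalfPlane.ne_zero z
  have hNc := natCast_N_ne_zero (N := N)
  have hp := natCast_p_ne_zero (p := p)
  have hD := frickeDP_mul_p hpN hs
  have hDc : ((frickeDP N s : ℤ) : ℂ) =
      (1 + (N : ℂ) * (s.val : ℂ) * ((pPartner N s).val : ℂ)) / (p : ℂ) := by
    rw [eq_div_iff hp]
    exact_mod_cast hD
  have hX : ((-((N : ℤ) * (s.val : ℤ)) : ℂ)) *
        ((((((pPartner N s).val : ℕ) : ℝ) / (p : ℝ) : ℝ) +ᵥ frickePoint N z : ℍ) : ℂ) +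
        (frickeDP N s : ℂ) =
      (p : ℂ) * ((-I * ((transDiv p (bOfS p s) z : ℍ) : ℂ)) / (-I * (z : ℂ))) := by
    rw [coe_vadd, coe_transDiv, coe_frickePoint, hDc, val_bOfS]
    push_cast
    field_simp
    ring
  have hw0 := csqrt_neg_I_mul_ne_zero (transDiv p (bOfS p s) z)
  have hJ := jacobiSym_pow_odd (p := p) ((ZMod.val_ne_zero _).mpr (pPartner_ne_zero hpN hs))
    (ZMod.val_lt _) hk
  unfold frickeFun
  rw [frickePoint_transDiv_bOfS hpN hs z, hf _ (frickeGammaP_mem hpN s hs),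
    autFactor_frickeGammaP hN hpN hs, hX, csqrt_p_mul,
    csqrt_div_of_re_pos (re_neg_I_mul_pos _) (re_neg_I_mul_pos z)]
  calc _ = ((Complex.sqrt (-I * ((transDiv p (bOfS p s) z : ℍ) : ℂ)))⁻¹ *
        Complex.sqrt (-I * ((transDiv p (bOfS p s) z : ℍ) : ℂ))) ^ k *
      ((χ (p : ZMod N))⁻¹ * ((thetaEps p)⁻¹ * (Real.sqrt p : ℂ)) ^ k *
        (J(((pPartner N s).val : ℤ) | p) : ℂ) ^ k *
        ((Complex.sqrt (-I * (z : ℂ)))⁻¹ ^ k *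
          f (((((pPartner N s).val : ℕ) : ℝ) / (p : ℝ) : ℝ) +ᵥ frickePoint N z))) := by ring
    _ = _ := by rw [inv_mul_cancel₀ hw0, one_pow, one_mul, hJ]

omit [NeZero N] in
/-- `((-1/p)(N/p)(t/p))² = 1` for `t ≢ 0`. [folklore] -/
theorem jacobi_prod_sq (hpN : ¬ p ∣ N) {t : ZMod p} (ht : t ≠ 0) :
    ((J(-1 | p) : ℂ) * (J((N : ℤ) | p) : ℂ) * (J((t.val : ℤ) | p) : ℂ)) ^ 2 = 1 := by
  have e1 : J(-1 | p) ^ 2 = 1 := jacobiSym.sq_one (by rw [Int.neg_gcd, Int.one_gcd])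
  have e2 : J((N : ℤ) | p) ^ 2 = 1 :=
    jacobiSym.sq_one (by rw [Int.gcd_natCast_natCast]; exact coprime_N_p hpN)
  have e3 : J((t.val : ℤ) | p) ^ 2 = 1 := jacobiSym.sq_one (gcd_val_eq_one ht)
  rw [mul_pow, mul_pow]
  exact_mod_cast (by rw [e1, e2, e3]; norm_num : (J(-1 | p) ^ 2 * J((N : ℤ) | p) ^ 2 *
    J((t.val : ℤ) | p) ^ 2 : ℤ) = 1)

/-- **(v) Translates**: `(W f)(z + t/p) = χ(p)⁻¹ ε_p^{-k} p^{-k/2} (-1/p)(N/p)(t/p) (-iz)^{-k/2} f((W z + p t')/p²)`.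
[folklore] -/
theorem frickeFun_vadd (hN : 8 ∣ N) (hpN : ¬ p ∣ N) (hk : Odd k) {f : ℍ → ℂ}
    (hf : ∀ γ ∈ Gamma0 N, ∀ z : ℍ, f (γ • z) = autFactor k N χ γ z * f z)
    {t : ZMod p} (ht : t ≠ 0) (z : ℍ) :
    frickeFun N k f ((((t.val : ℕ) : ℝ) / (p : ℝ) : ℝ) +ᵥ z) =
      (χ (p : ZMod N))⁻¹ * (thetaEps p)⁻¹ ^ k * ((Real.sqrt p : ℂ))⁻¹ ^ k *
        ((J(-1 | p) : ℂ) * (J((N : ℤ) | p) : ℂ) * (J((t.val : ℤ) | p) : ℂ)) *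
        ((Complex.sqrt (-I * (z : ℂ)))⁻¹ ^ k *
          f (transDiv p (bOfS p (pPartner N t)) (frickePoint N z))) := by
  have hz := UpperHalfPlane.ne_zero z
  have hNc := natCast_N_ne_zero (N := N)
  have hp := natCast_p_ne_zero (p := p)
  have hsp : (Real.sqrt p : ℂ) ≠ 0 := by
    exact_mod_cast (Real.sqrt_pos.mpr (by exact_mod_cast (Fact.out : p.Prime).pos)).ne'
  have hD := frickeDP_mul_p hpN ht
  have hDc : ((frickeDP N t : ℤ) : ℂ) =
      (1 + (N : ℂ) * (t.val : ℂ) * ((pPartner N t).val : ℂ)) / (p : ℂ) := by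
    rw [eq_div_iff hp]
    exact_mod_cast hD
  have hX : ((-((N : ℤ) * (t.val : ℤ)) : ℂ)) *
        ((transDiv p (bOfS p (pPartner N t)) (frickePoint N z) : ℍ) : ℂ) + (frickeDP N t : ℂ) =
      ((-I * (((((t.val : ℕ) : ℝ) / (p : ℝ) : ℝ) +ᵥ z : ℍ) : ℂ)) / (-I * (z : ℂ))) / (p : ℂ) := by
    rw [coe_vadd, coe_transDiv, coe_frickePoint, hDc, val_bOfS]
    push_cast
    field_simp
    ring
  -- `√X = √((-iw)/(-iz)) / √p`
  have hsqrtX : Complex.sqrt (((-I * (((((t.val : ℕ) : ℝ) / (p : ℝ) : ℝ) +ᵥ z : ℍ) : ℂ)) /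
        (-I * (z : ℂ))) / (p : ℂ)) =
      Complex.sqrt (-I * (((((t.val : ℕ) : ℝ) / (p : ℝ) : ℝ) +ᵥ z : ℍ) : ℂ)) /
        Complex.sqrt (-I * (z : ℂ)) / (Real.sqrt p : ℂ) := by
    rw [eq_div_iff hsp, mul_comm, ← csqrt_p_mul, mul_div_cancel₀ _ hp,
      csqrt_div_of_re_pos (re_neg_I_mul_pos _) (re_neg_I_mul_pos z)]
  have hw0 := csqrt_neg_I_mul_ne_zero (((((t.val : ℕ) : ℝ) / (p : ℝ) : ℝ) +ᵥ z : ℍ))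
  have hP := pow_eq_self_of_sq_eq_one (jacobi_prod_sq hpN ht) hk
  unfold frickeFun
  rw [frickePoint_vadd hpN ht z, hf _ (frickeGammaP_mem hpN t ht),
    autFactor_frickeGammaP' hN hpN ht, hX, hsqrtX]
  calc _ = ((Complex.sqrt (-I * (((((t.val : ℕ) : ℝ) / (p : ℝ) : ℝ) +ᵥ z : ℍ) : ℂ)))⁻¹ *
        Complex.sqrt (-I * (((((t.val : ℕ) : ℝ) / (p : ℝ) : ℝ) +ᵥ z : ℍ) : ℂ))) ^ k *
      ((χ (p : ZMod N))⁻¹ * (thetaEps p)⁻¹ ^ k * ((Real.sqrt p : ℂ))⁻¹ ^ k *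
        ((J(-1 | p) : ℂ) * (J((N : ℤ) | p) : ℂ) * (J((t.val : ℤ) | p) : ℂ)) ^ k *
        ((Complex.sqrt (-I * (z : ℂ)))⁻¹ ^ k *
          f (transDiv p (bOfS p (pPartner N t)) (frickePoint N z)))) := by ring
    _ = _ := by rw [inv_mul_cancel₀ hw0, one_pow, one_mul, hP]

end FrickeD

/-! ## Part 6. Regrouping the sums: `T(p²)(W f) = χ(p)⁻² · W (T(p²) f)` -/

section FrickeE

variable {k N : ℕ} [NeZero N] {χ χ' : DirichletCharacter ℂ N} {p : ℕ} [Fact p.Prime]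

/-! ### The non-units modulo `p²` are the `p s` -/

omit [NeZero N] in
/-- `p s` is not a unit modulo `p²`. [folklore] -/
theorem not_isUnit_bOfS (s : ZMod p) : ¬ IsUnit (bOfS p s) := by
  intro h
  have hp : p.Prime := Fact.out
  rw [bOfS, ZMod.isUnit_iff_coprime] at h
  exact Nat.not_coprime_of_dvd_of_dvd hp.one_lt (dvd_mul_right p _) (dvd_pow_self p two_ne_zero) h

omit [NeZero N] in
/-- `s ↦ p s` is injective. [folklore] -/
theorem bOfS_injective : Function.Injective (bOfS p) := by
  intro s s' h
  have h' := congrArg ZMod.val h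
  rw [val_bOfS, val_bOfS] at h'
  exact ZMod.val_injective p (Nat.eq_of_mul_eq_mul_left (Fact.out : p.Prime).pos h')

omit [NeZero N] in
/-- A non-unit modulo `p²` is of the form `p s`. [folklore] -/
theorem exists_bOfS_of_not_isUnit {b : ZMod (p ^ 2)} (hb : ¬ IsUnit b) : ∃ s, bOfS p s = b := by
  haveI : NeZero (p ^ 2) := ⟨pow_ne_zero 2 (Fact.out : p.Prime).ne_zero⟩
  have hp : p.Prime := Fact.out
  have hdvd : p ∣ b.val := by
    by_contra hnd
    apply hb
    rw [← ZMod.natCast_zmod_val b, ZMod.isUnit_iff_coprime]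
    exact Nat.Coprime.pow_right 2 (Nat.coprime_comm.mp ((hp.coprime_iff_not_dvd).mpr hnd))
  obtain ⟨m, hm⟩ := hdvd
  have hm_lt : m < p := by
    have h1 := ZMod.val_lt b
    rw [hm, sq] at h1
    exact Nat.lt_of_mul_lt_mul_left h1
  refine ⟨(m : ZMod p), ?_⟩
  rw [bOfS, ZMod.val_natCast, Nat.mod_eq_of_lt hm_lt, ← hm, ZMod.natCast_zmod_val]

/-! ### Four finite-sum manipulations -/

omit [NeZero N] in
/-- **Splitting `ℤ/p²` into units and multiples of `p`.** [folklore] -/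
theorem sum_zmod_sq_split (G : ZMod (p ^ 2) → ℂ) :
    ∑ b : ZMod (p ^ 2), G b =
      (∑ b : ZMod (p ^ 2), if IsUnit b then G b else 0) + ∑ s : ZMod p, G (bOfS p s) := by
  classical
  have h1 : ∑ b : ZMod (p ^ 2), G b =
      (∑ b : ZMod (p ^ 2), if IsUnit b then G b else 0) +
        ∑ b : ZMod (p ^ 2), if IsUnit b then 0 else G b := by
    rw [← Finset.sum_add_distrib]
    refine Finset.sum_congr rfl fun b _ ↦ ?_
    split_ifs <;> simp
  have h2 : ∑ s : ZMod p, G (bOfS p s) =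
      ∑ s : ZMod p, (fun b ↦ if IsUnit b then 0 else G b) (bOfS p s) := by
    refine Finset.sum_congr rfl fun s _ ↦ ?_
    simp only [if_neg (not_isUnit_bOfS s)]
  have h3 : ∑ b ∈ (Finset.univ : Finset (ZMod p)).image (bOfS p),
      (fun b ↦ if IsUnit b then 0 else G b) b =
      ∑ s : ZMod p, (fun b ↦ if IsUnit b then 0 else G b) (bOfS p s) :=
    Finset.sum_image fun s _ s' _ h ↦ bOfS_injective h
  have h4 : ∑ b ∈ (Finset.univ : Finset (ZMod p)).image (bOfS p),
      (fun b ↦ if IsUnit b then 0 else G b) b =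
      ∑ b : ZMod (p ^ 2), (fun b ↦ if IsUnit b then 0 else G b) b := by
    apply Finset.sum_subset (Finset.subset_univ _)
    intro b _ hb
    have hu : IsUnit b := by
      by_contra hu
      obtain ⟨s, hs⟩ := exists_bOfS_of_not_isUnit hu
      exact hb (Finset.mem_image.mpr ⟨s, Finset.mem_univ _, hs⟩)
    simp only [if_pos hu]
  rw [h1, h2, ← h3, h4]

omit [NeZero N] in
/-- **Reindexing the units by `b ↦ b'`.** [folklore] -/
theorem sum_units_unitPartner (hpN : ¬ p ∣ N) (G : ZMod (p ^ 2) → ℂ) :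
    (∑ b : ZMod (p ^ 2), if IsUnit b then G (unitPartner N b) else 0) =
      ∑ b : ZMod (p ^ 2), if IsUnit b then G b else 0 := by
  classical
  let φ : ZMod (p ^ 2) → ZMod (p ^ 2) := fun b ↦ if IsUnit b then unitPartner N b else b
  have hφu : ∀ {b : ZMod (p ^ 2)}, IsUnit b → φ b = unitPartner N b := fun hb ↦ if_pos hb
  have hφn : ∀ {b : ZMod (p ^ 2)}, ¬ IsUnit b → φ b = b := fun hb ↦ if_neg hb
  have hinv : Function.Involutive φ := by
    intro b
    by_cases hb : IsUnit b
    · rw [hφu hb, hφu (isUnit_unitPartner hpN hb), unitPartner_unitPartner hpN hb]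
    · rw [hφn hb, hφn hb]
  refine Fintype.sum_equiv hinv.toPerm _ _ fun b ↦ ?_
  rw [Function.Involutive.coe_toPerm]
  by_cases hb : IsUnit b
  · rw [hφu hb, if_pos hb, if_pos (isUnit_unitPartner hpN hb)]
  · rw [hφn hb, if_neg hb, if_neg hb]

omit [NeZero N] in
/-- **Reindexing `ℤ/p` by `t ↦ t'`.** [folklore] -/
theorem sum_pPartner (hpN : ¬ p ∣ N) (K : ZMod p → ℂ) :
    ∑ t : ZMod p, K (pPartner N t) = ∑ t : ZMod p, K t :=
  Fintype.sum_equiv (Function.Involutive.toPerm _ (pPartner_pPartner hpN)) _ _ fun _ ↦ rfl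

omit [NeZero N] in
/-- **Splitting off `t = 0`.** [folklore] -/
theorem sum_eq_zero_add (K : ZMod p → ℂ) :
    ∑ t : ZMod p, K t = K 0 + ∑ t : ZMod p, if t = 0 then 0 else K t := by
  have h : ∀ t : ZMod p, K t = (if t = 0 then K t else 0) + (if t = 0 then 0 else K t) := by
    intro t
    split_ifs <;> simp
  rw [Finset.sum_congr rfl (fun t _ ↦ h t), Finset.sum_add_distrib, Finset.sum_ite_eq']
  simp

/-! ### The scalar identities -/

omit [NeZero N] in
/-- `ε_p⁻² = (-1/p)` for the odd prime `p`. [folklore] -/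
theorem thetaEps_inv_sq_eq_jacobi (hN : 8 ∣ N) (hpN : ¬ p ∣ N) :
    (thetaEps p)⁻¹ ^ 2 = (J(-1 | p) : ℂ) := by
  have hodd := p_odd hN hpN
  have h4 : p % 4 = 1 ∨ p % 4 = 3 := by have := Nat.odd_iff.mp hodd; omega
  rw [thetaEps_inv_sq, jacobiSym.at_neg_one hodd, ZMod.χ₄_nat_eq_if_mod_four]
  rcases h4 with h | h
  · rw [if_neg (by omega), if_neg (by omega), if_pos h]; simp
  · rw [if_pos (by omega), if_neg (by omega), if_neg (by omega)]; simp

/-- **`T(p²)(W f) = χ(p)⁻² · W(T(p²) f)`**: the Hecke operator `T(p²)` of weight `k/2`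
(`k` odd) and the Fricke involution `W_N` (`8 ∣ N`, `p ∤ N`) commute up to the scalar
`χ̄(p²)`, the operator on the left being taken with the character `χ'` of the target space,
`χ'(p) = χ̄(p) (N/p)`. Here `f` is any function with the automorphy
`f(γz) = χ(d) j(γ, z)^k f(z)` on `Γ₀(N)` (e.g. `f ∈ M_{k/2}(N, χ)`), and both sides are Shimura's
explicit averages `heckeFun` (Shimura 1973, §1 and Prop. 1.5: `W_N` normalises `Γ₀(N)` and
the double coset of `diag(1, p²)`). The proof matches the `p² + p + 1` terms on each side through
the cofactors `γ_b`, `δ_s` above. [cite: Shimura1973HalfIntegral, §1, Prop. 1.5] -/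
theorem heckeFun_frickeFun (hN : 8 ∣ N) (hpN : ¬ p ∣ N) (hk : Odd k) {f : ℍ → ℂ}
    (hf : ∀ γ ∈ Gamma0 N, ∀ z : ℍ, f (γ • z) = autFactor k N χ γ z * f z)
    (hχ' : χ' (p : ZMod N) = (χ (p : ZMod N))⁻¹ * (J((N : ℤ) | p) : ℂ)) (z : ℍ) :
    heckeFun k χ' p (frickeFun N k f) z =
      (χ (p : ZMod N))⁻¹ ^ 2 * frickeFun N k (heckeFun k χ p f) z := by
  classical
  have hp : p.Prime := Fact.out
  have hp0 := natCast_p_ne_zero (p := p)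
  have hc := chi_p_ne_zero' (χ := χ) hpN
  have hr0 : (Real.sqrt p : ℂ) ≠ 0 := by
    exact_mod_cast (Real.sqrt_pos.mpr (by exact_mod_cast hp.pos)).ne'
  have hJ0 : ∀ x : ℍ, (J(((0 : ZMod p).val : ℤ) | p) : ℂ) * f x = 0 := fun x ↦ by
    rw [ZMod.val_zero, Nat.cast_zero, jacobiSym.zero_left hp.one_lt, Int.cast_zero, zero_mul]
  -- notation
  set u := frickePoint N z with hu
  set R := (Complex.sqrt (-I * (z : ℂ)))⁻¹ ^ k with hR
  set c := χ (p : ZMod N) with hcdef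
  set E := (thetaEps p)⁻¹ * (Real.sqrt p : ℂ) with hE
  set U := ∑ b : ZMod (p ^ 2), if IsUnit b then f (transDiv p b u) else 0 with hU
  set S₀ := ∑ s : ZMod p, if s = 0 then 0 else f (transDiv p (bOfS p s) u) with hS₀
  set B := ∑ t : ZMod p, (J((t.val : ℤ) | p) : ℂ) * f ((((t.val : ℕ) : ℝ) / (p : ℝ) : ℝ) +ᵥ u)
    with hB
  set f₀ := f (transDiv p (bOfS p 0) u) with hf₀
  set fm := f (mulPSq p u) with hfm
  -- (1) the `b`-sum of the left-hand side
  have hA' : ∑ b : ZMod (p ^ 2), frickeFun N k f (transDiv p b z) =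
      c⁻¹ ^ 2 * R * U + (p : ℂ) ^ k * R * fm + c⁻¹ * E ^ k * R * B := by
    rw [sum_zmod_sq_split, sum_eq_zero_add (p := p)]
    -- units
    have h1 : (∑ b : ZMod (p ^ 2), if IsUnit b then frickeFun N k f (transDiv p b z) else 0) =
        c⁻¹ ^ 2 * R * U := by
      rw [hU, ← sum_units_unitPartner hpN (fun b ↦ f (transDiv p b u)), Finset.mul_sum]
      refine Finset.sum_congr rfl fun b _ ↦ ?_
      by_cases hb : IsUnit b
      · rw [if_pos hb, if_pos hb, frickeFun_transDiv_unit hN hpN hf hb z, ← hu, ← hR]; ring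
      · rw [if_neg hb, if_neg hb, mul_zero]
    -- `s = 0`
    have h2 : frickeFun N k f (transDiv p (bOfS p 0) z) = (p : ℂ) ^ k * R * fm := by
      rw [bOfS_zero, transDiv_zero, frickeFun_divPSq, ← hu, ← hR, hfm]; ring
    -- `s ≠ 0`
    have h3 : (∑ s : ZMod p, if s = 0 then 0 else frickeFun N k f (transDiv p (bOfS p s) z)) =
        c⁻¹ * E ^ k * R * B := by
      have h3a : ∀ s : ZMod p, (if s = 0 then 0 else frickeFun N k f (transDiv p (bOfS p s) z)) =
          c⁻¹ * E ^ k * R * (fun t : ZMod p ↦ (J((t.val : ℤ) | p) : ℂ) *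
            f ((((t.val : ℕ) : ℝ) / (p : ℝ) : ℝ) +ᵥ u)) (pPartner N s) := by
        intro s
        by_cases hs : s = 0
        · rw [if_pos hs, hs, pPartner_zero]
          simp only [hJ0, mul_zero]
        · rw [if_neg hs, frickeFun_transDiv_bOfS hN hpN hk hf hs z, ← hu, ← hR, ← hcdef, ← hE]
          simp only
          ring
      rw [Finset.sum_congr rfl (fun s _ ↦ h3a s), ← Finset.mul_sum,
        sum_pPartner hpN (fun t : ZMod p ↦ (J((t.val : ℤ) | p) : ℂ) *
          f ((((t.val : ℕ) : ℝ) / (p : ℝ) : ℝ) +ᵥ u))]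
    rw [h1, h2, h3]
    ring
  -- (2) the `t`-sum of the left-hand side
  have hB' : ∑ t : ZMod p, (J((t.val : ℤ) | p) : ℂ) *
        frickeFun N k f ((((t.val : ℕ) : ℝ) / (p : ℝ) : ℝ) +ᵥ z) =
      c⁻¹ * (thetaEps p)⁻¹ ^ k * ((Real.sqrt p : ℂ))⁻¹ ^ k *
        ((J(-1 | p) : ℂ) * (J((N : ℤ) | p) : ℂ)) * R * S₀ := by
    have h4 : ∀ t : ZMod p, (J((t.val : ℤ) | p) : ℂ) *
        frickeFun N k f ((((t.val : ℕ) : ℝ) / (p : ℝ) : ℝ) +ᵥ z) =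
        c⁻¹ * (thetaEps p)⁻¹ ^ k * ((Real.sqrt p : ℂ))⁻¹ ^ k *
          ((J(-1 | p) : ℂ) * (J((N : ℤ) | p) : ℂ)) * R *
          (fun s : ZMod p ↦ if s = 0 then 0 else f (transDiv p (bOfS p s) u)) (pPartner N t) := by
      intro t
      by_cases ht : t = 0
      · simp only [ht, pPartner_zero, if_true, mul_zero]
        rw [ZMod.val_zero, Nat.cast_zero, jacobiSym.zero_left hp.one_lt, Int.cast_zero, zero_mul]
      · have hsq : (J((t.val : ℤ) | p) : ℂ) * (J((t.val : ℤ) | p) : ℂ) = 1 := by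
          rw [← sq]; exact_mod_cast jacobiSym.sq_one (gcd_val_eq_one ht)
        simp only [if_neg (pPartner_ne_zero hpN ht)]
        rw [frickeFun_vadd hN hpN hk hf ht z, ← hu, ← hR, ← hcdef]
        linear_combination (c⁻¹ * (thetaEps p)⁻¹ ^ k * ((Real.sqrt p : ℂ))⁻¹ ^ k *
          ((J(-1 | p) : ℂ) * (J((N : ℤ) | p) : ℂ)) * R *
          f (transDiv p (bOfS p (pPartner N t)) u)) * hsq
    rw [Finset.sum_congr rfl (fun t _ ↦ h4 t), ← Finset.mul_sum,
      sum_pPartner hpN (fun s : ZMod p ↦ if s = 0 then 0 else f (transDiv p (bOfS p s) u))]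
  -- (3) the last term of the left-hand side
  have hC' : frickeFun N k f (mulPSq p z) = ((p : ℂ))⁻¹ ^ k * R * f₀ := by
    rw [frickeFun_mulPSq, ← hu, ← hR, hf₀, bOfS_zero, transDiv_zero]; ring
  -- (4) the `b`-sum of the right-hand side
  have hA : ∑ b : ZMod (p ^ 2), f (transDiv p b u) = U + (f₀ + S₀) := by
    rw [sum_zmod_sq_split, sum_eq_zero_add (p := p)]
  -- (5) the scalar identities
  have hJN2 : (J((N : ℤ) | p) : ℂ) ^ 2 = 1 := by
    exact_mod_cast jacobiSym.sq_one (by rw [Int.gcd_natCast_natCast]; exact coprime_N_p hpN)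
  have hJ12' : J(-1 | p) ^ 2 = 1 := jacobiSym.sq_one (by rw [Int.neg_gcd, Int.one_gcd])
  have hJ12 : (J(-1 | p) : ℂ) ^ 2 = 1 := by exact_mod_cast hJ12'
  have hJ1k : (J(-1 | p) : ℂ) ^ k = J(-1 | p) := pow_eq_self_of_sq_eq_one hJ12 hk
  have hεsq := thetaEps_inv_sq_eq_jacobi hN hpN
  have key1 : (c⁻¹ * (J((N : ℤ) | p) : ℂ)) * E ^ k *
      (c⁻¹ * (thetaEps p)⁻¹ ^ k * ((Real.sqrt p : ℂ))⁻¹ ^ k *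
        ((J(-1 | p) : ℂ) * (J((N : ℤ) | p) : ℂ))) = c⁻¹ ^ 2 := by
    calc _ = c⁻¹ ^ 2 * (J((N : ℤ) | p) : ℂ) ^ 2 * ((thetaEps p)⁻¹ ^ 2) ^ k * (J(-1 | p) : ℂ) *
          ((Real.sqrt p : ℂ) * ((Real.sqrt p : ℂ))⁻¹) ^ k := by rw [hE]; ring
      _ = c⁻¹ ^ 2 * (J(-1 | p) : ℂ) ^ 2 := by
          rw [hJN2, hεsq, hJ1k, mul_inv_cancel₀ hr0, one_pow]; ring
      _ = c⁻¹ ^ 2 := by rw [hJ12, mul_one]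
  have key2 : (c⁻¹ * (J((N : ℤ) | p) : ℂ)) ^ 2 * (p : ℂ) ^ k * ((p : ℂ))⁻¹ ^ k = c⁻¹ ^ 2 := by
    calc _ = c⁻¹ ^ 2 * (J((N : ℤ) | p) : ℂ) ^ 2 * ((p : ℂ) * ((p : ℂ))⁻¹) ^ k := by ring
      _ = c⁻¹ ^ 2 := by rw [hJN2, mul_inv_cancel₀ hp0, one_pow, mul_one, mul_one]
  have key3 : c⁻¹ ^ 2 * c = c⁻¹ := by field_simp
  have key4 : c⁻¹ ^ 2 * c ^ 2 = 1 := by field_simp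
  -- assemble
  have hLHS : heckeFun k χ' p (frickeFun N k f) z = ((p : ℂ) ^ 2)⁻¹ *
      (∑ b : ZMod (p ^ 2), frickeFun N k f (transDiv p b z) +
        χ' (p : ZMod N) * E ^ k * ∑ t : ZMod p, (J((t.val : ℤ) | p) : ℂ) *
          frickeFun N k f ((((t.val : ℕ) : ℝ) / (p : ℝ) : ℝ) +ᵥ z) +
        χ' (p : ZMod N) ^ 2 * (p : ℂ) ^ k * frickeFun N k f (mulPSq p z)) := by
    rw [heckeFun, map_pow]
  have hRHS : frickeFun N k (heckeFun k χ p f) z = R * (((p : ℂ) ^ 2)⁻¹ *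
      (∑ b : ZMod (p ^ 2), f (transDiv p b u) + c * E ^ k * B + c ^ 2 * (p : ℂ) ^ k * fm)) := by
    rw [frickeFun, heckeFun, map_pow]
  rw [hLHS, hRHS, hA', hB', hC', hA, hχ']
  linear_combination ((p : ℂ) ^ 2)⁻¹ * R * S₀ * key1 + ((p : ℂ) ^ 2)⁻¹ * R * f₀ * key2 -
    ((p : ℂ) ^ 2)⁻¹ * R * E ^ k * B * key3 - ((p : ℂ) ^ 2)⁻¹ * R * (p : ℂ) ^ k * fm * key4

end FrickeE

/-! ## Part 7. Transfer of eigenvalues along the Fricke involution -/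

section FrickeF

variable {k N : ℕ} [NeZero N] {χ χ' : DirichletCharacter ℂ N} {p : ℕ} [Fact p.Prime]

omit [NeZero N] in
/-- `T(p²)` (the explicit average) is homogeneous: `T(p²)(c g) = c T(p²) g`. [folklore] -/
theorem heckeFun_const_mul (c : ℂ) (g : ℍ → ℂ) (z : ℍ) :
    heckeFun k χ' p (fun w ↦ c * g w) z = c * heckeFun k χ' p g z := by
  unfold heckeFun
  have h1 : ∑ b : ZMod (p ^ 2), c * g (transDiv p b z) = c * ∑ b : ZMod (p ^ 2), g (transDiv p b z) := by
    rw [Finset.mul_sum]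
  have h2 : ∑ t : ZMod p, (J((t.val : ℤ) | p) : ℂ) * (c * g ((((t.val : ℕ) : ℝ) / (p : ℝ) : ℝ) +ᵥ z)) =
      c * ∑ t : ZMod p, (J((t.val : ℤ) | p) : ℂ) * g ((((t.val : ℕ) : ℝ) / (p : ℝ) : ℝ) +ᵥ z) := by
    rw [Finset.mul_sum]
    exact Finset.sum_congr rfl fun t _ ↦ by ring
  rw [h1, h2]
  ring

omit [NeZero N] in
/-- `qCoeffs (F - c • G) = qCoeffs F - c • qCoeffs G` on `M_{k/2}(N, χ)`. [folklore] -/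
theorem qCoeffs_sub_smul {F G : ℍ → ℂ} (hF : F ∈ halfIntModularForms k N χ)
    (hG : G ∈ halfIntModularForms k N χ) (c : ℂ) :
    qCoeffs (F - c • G) = qCoeffs F - c • qCoeffs G := by
  rw [sub_eq_add_neg, ← _root_.neg_smul, qCoeffs_add hF (Submodule.smul_mem _ _ hG),
    qCoeffs_smul hG, _root_.neg_smul, ← sub_eq_add_neg]

omit [NeZero N] in
/-- An eigenform of `T(p²)` on `q`-expansions is an eigenfunction of the average `heckeFun`:
`T(p²) f = λ f` as functions. [cite: Shimura1973HalfIntegral, Thm. 1.7] -/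
theorem heckeFun_eq_smul_of_heckeTSq (hN4 : 4 ∣ N) (hk : Odd k) {f : ℍ → ℂ}
    (hf : f ∈ halfIntModularForms k N χ) {ev : ℂ}
    (hev : heckeTSq k χ p (qCoeffs f) = ev • qCoeffs f) : heckeFun k χ p f = ev • f := by
  have hmem := heckeFun_mem (p := p) hN4 hk hf
  have hdiff : heckeFun k χ p f - ev • f ∈ halfIntModularForms k N χ :=
    sub_mem hmem (Submodule.smul_mem _ _ hf)
  have h0 := eq_zero_of_qCoeffs_eq_zero hdiff (by
    rw [qCoeffs_sub_smul hmem hf, qCoeffs_heckeFun hN4 hk hf, hev, sub_self])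
  exact sub_eq_zero.mp h0

/-- **Transfer of eigenvalues along `W_N`.** Let `8 ∣ N`, `p ∤ N` prime, `k` odd,
`f ∈ M_{k/2}(N, χ)`, `g ∈ M_{k/2}(N, χ')` with `χ'(p) = χ̄(p) (N/p)`, and suppose
`W_N f = c · g` for a constant `c ≠ 0`. If `f` is an eigenform of `T(p²)` with eigenvalue `λ`
(on `q`-expansions), then `g` is an eigenform of `T(p²)` with eigenvalue `χ̄(p)² λ`.
[cite: Shimura1973HalfIntegral, §1, Prop. 1.5] -/
theorem heckeTSq_eq_smul_of_frickeFun (hN8 : 8 ∣ N) (hpN : ¬ p ∣ N) (hk : Odd k)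
    {f g : ℍ → ℂ} (hf : f ∈ halfIntModularForms k N χ) (hg : g ∈ halfIntModularForms k N χ')
    (hχ' : χ' (p : ZMod N) = (χ (p : ZMod N))⁻¹ * (J((N : ℤ) | p) : ℂ))
    {c : ℂ} (hc : c ≠ 0) (hW : ∀ z : ℍ, frickeFun N k f z = c * g z)
    {ev : ℂ} (hev : heckeTSq k χ p (qCoeffs f) = ev • qCoeffs f) :
    heckeTSq k χ' p (qCoeffs g) = ((χ (p : ZMod N))⁻¹ ^ 2 * ev) • qCoeffs g := by
  have hN4 : 4 ∣ N := dvd_trans ⟨2, by norm_num⟩ hN8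
  have hTf := heckeFun_eq_smul_of_heckeTSq (p := p) hN4 hk hf hev
  have hfa : ∀ γ ∈ Gamma0 N, ∀ z : ℍ, f (γ • z) = autFactor k N χ γ z * f z :=
    fun γ hγ z ↦ apply_smul_eq_of_mem hN4 hf hγ z
  have hWfun : frickeFun N k f = fun w ↦ c * g w := funext hW
  -- `T(p²) g = χ̄(p)² λ g` as functions
  have hTg : heckeFun k χ' p g = ((χ (p : ZMod N))⁻¹ ^ 2 * ev) • g := by
    funext z
    have h := heckeFun_frickeFun (χ' := χ') hN8 hpN hk hfa hχ' z
    rw [hWfun, heckeFun_const_mul, hTf] at h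
    have h2 : frickeFun N k (ev • f) z = ev * frickeFun N k f z :=
      frickeFun_const_mul k ev f z
    rw [h2, hW z] at h
    apply mul_left_cancel₀ hc
    rw [h, Pi.smul_apply, smul_eq_mul]
    ring
  rw [← qCoeffs_heckeFun hN4 hk hg, hTg, qCoeffs_smul hg]

end FrickeF

end Literature.NumberTheory.EllipticCurves.ModularForms
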